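import Summits.KontsevichZagierPeriods.KontsevichZagierPeriods.Theses.HurwitzMicroSectors
import Literature.NumberTheory.Transcendental.CalegariDimitrovTangL2Chi3
import Literature.NumberTheory.Transcendental.CalegariDimitrovTangL2Chi3Reduction
import Literature.NumberTheory.Transcendental.BoxIntegralHurwitzWeightTwo
import Literature.NumberTheory.Transcendental.KZLogCalculusProofs
import Literature.NumberTheory.Transcendental.KZRelationsLE
import Literature.NumberTheory.Transcendental.KZMellinFibres
import Literature.NumberTheory.Transcendental.KZSubcalculusInvariants

/-!
# Disproof of `SectorTwoSix` (stmt-KontsevichZagierPeriods-3870) — standing adversary, findings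

Crux (route HurwitzMicroSectors, rank 2):
`SectorTwoSix : CDT → ∀ r r' : KZ.IntegralRep 2, ∀ P P' : ℚ[t], r.domain = (0,1)² → r'.domain = (0,1)²
  → r.integrand =_{(0,1)²} P(x₀x₁)/(1−(x₀x₁)⁶) → r'.integrand =_{(0,1)²} P'(x₀x₁)/(1−(x₀x₁)⁶)
  → r.value = r'.value → KZ.Equivalent r r'`,
where `CDT` is LITERALLY the named (unproved) fact
`Literature.NumberTheory.Transcendental.calegariDimitrovTang_linearIndependent`
(`LinearIndependent ℚ ![1, π², Σ' n (1/(3n+1)² − 1/(3n+2)²)]`, Calegari–Dimitrov–Tang 2024, Thm. 1).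

VERDICT (cycles 1–5): NO KILL — THE CRUX IS A THEOREM.  `sectorTwoSix : SectorTwoSix` is PROVED in
§7 of this file (sorry-free; axioms propext, Classical.choice, Quot.sound), together with crux
`DilationMove` (stmt-…-3872) verbatim (`dilationMove`).  Formally no kill was ever possible short of
formalising CDT's 137-page theorem (`not_iff : ¬ SectorTwoSix ↔ CDT ∧ ¬ Conclusion`, and
`Conclusion` is a special case of the summit, `conclusion_of_summit`); mathematically the conclusion
holds under CDT by an explicit move chain, now machine-checked: partial fractions = rule 1b; the
distribution relations AND the monomial evaluations `[box, tᵏ] ∼ [box, (k+1)⁻²]` are each ONE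
dilation `xᵢ ↦ xᵢ^m` (rule 2, polynomial Jacobian `m² t^{m−1}`; for the monomial take `m = k+1`
and a constant target integrand — no Newton–Leibniz is needed anywhere); rational rescaling of
chains = `KZ.scale` (tree, proved), so the planner's "no division rule" worry is void; rigidity of
the normal form `A(1−t⁶) + Bt³ + Ct⁵` = CDT.  WHAT ANY PROOF MUST USE (cycles 4–5, all landed under
`Theorems/SectorTwoSix/Negative/`): the value hypothesis (§2); CDT exactly at the rigidity step
(`NfRigidity ↔ CDT`, §11; CDT-free residue §13); and, among the Newton–Leibniz-free move types, BOTH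
integrand additivity (1b) and change of variables (2) — neither `closure (1a ∪ 1b)` (§10, restricted
evaluation) nor `closure (1a ∪ 2)` (§12, positive-part mass) proves it, while `closure (1b ∪ 2)` does
(§14, `nlFree_characterisation`); rule (3) can never be the first move on the open box (§15).
A refuter cannot land positive theorems: §6–§7 are
attached as evidence (files `SectorTwoSixProof.lean` on stmt-3870, `DilationMoveProof.lean` on
stmt-3872) for a prover to land under `Theorems/`.

INDEX
* §0 read-back: `box`, `sectorFun`, `Conclusion`, `crux_iff` (`Iff.rfl`).
* §1 shape of any refutation: `isRational_of_sector`, `conclusion_of_summit`, `of_summit`,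
  `not_summit_of_not`, `cdt_of_not`, `not_iff`, `not_conclusion_iff`, `not_of_separating_invariant`.
* §2 load-bearing hypotheses: `not_withoutValueEq` (drop `r.value = r'.value`: FALSE, witness
  `[box, 0]` vs `[box, 1] = [box, (1−t⁶)/(1−t⁶)]`); `cdt_imp_withoutValueEq_iff_not_cdt` (with the CDT
  antecedent kept, that mutilated crux is equivalent to `¬ CDT`); the other hypotheses (domains,
  `EqOn`, CDT itself) drop to statements IMPLIED BY THE SUMMIT (`…_of_summit`), hence unrefutable
  without refuting Conjecture 1 — CDT is load-bearing for PROVABILITY, not for truth.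
* §3 non-vacuity / explicit generators: `constRep a`, `sectorRep P` (every `P ∈ ℚ[t]` IS carried by a
  representation: the `∀ r` is not vacuous), `value_constRep`, `value_sectorRep_monomial`
  (`= Σ_j (6j+k+1)⁻²`), `of_sub_of_sectorRep_mem_relations` (off-domain freedom is a relation).
* §4 why it resists — the move chain, side conditions checked (docstrings), and the syzygies:
  `value_sectorRep_one_add_X_pow_three_eq` (`[1 + t³]` and `[4t]` have equal values: `H₀ + H₃ = 4H₁`),
  so the natural strengthening "equal values ⇒ equal numerators" is FALSE (`not_numeratorRigidity`):
  the conclusion has content and needs genuine moves (the `m = 2` dilation).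
* §5 numerics (kit job j007839 — `compute/sector26.py`, 120-digit mpmath + exact sympy; QUEUED when this
  file was published, its `outputs/summary.json` attaches to the item automatically): closed forms of
  `H₀…H₅` and the four relations (cross-check of the tree's EXACT `BoxIntegral.level_six_relations`);
  PSLQ on `(1, π², L)` and `(1, H₃, H₅)` with coefficient bounds 10⁶…10¹⁵ (CDT proves there is no
  relation at all; the run only logs the bound reached); exact rank count: the dilation + shift
  relation polynomials have codimension 3 in `ℚ[t]_{≤d}` for `d = 6..40`, i.e. they span
  `ker(value)` iff `1, π², L` are independent — superseded anyway by the PROOF in §6–§7.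
* §6 THE TYPED ENGINE (the precise sense in which the crux "resists"): single-move targets
  `TMono k` (`[box,tᵏ] − [box,(k+1)⁻²] ∈ relations`: ONE dilation with `m = k+1`, see §7),
  `TDil2 r` / `TDil3 r` (ONE dilation `xᵢ ↦ xᵢ^m`, `m = 2, 3` = crux `DilationMove` at `n = 2`),
  `Targets := (∀ k, TMono k) ∧ TDil2 0 ∧ TDil2 1 ∧ TDil2 2 ∧ TDil3 1`; the class map
  `cls : ℚ[t] → FormalRep ⧸ relations` (additive: rule 1b; `ℚ`-homogeneous: `KZ.scale`), the normal
  form `nfP (A,B,C) = A(1−t⁶) + Bt³ + Ct⁵` and coefficient map `N`; `cls_eq_cls_nfP` (Targets ⇒ every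
  numerator reduces), `value_sectorRep_nfP`, `nfP_rigid` (CDT ⇒ rigidity), and
  **`conclusion_iff_targets : CDT → (Conclusion ↔ Targets)`**, `sectorTwoSix_of_targets :
  Targets → SectorTwoSix`, `targets_of_sectorTwoSix : SectorTwoSix → CDT → Targets`.
  So the crux is EXACTLY as hard as four dilation instances plus the monomial evaluation, each a single
  move; `TDil3 0` (`H₀+H₂+H₄ = 9H₂`) is redundant and `TDil2 1` (`H₁+H₄ = 4H₃`) is the relation
  dependent on the printed four at VALUE level but is USED at move level.
* §7 THE TARGETS DISCHARGED: `dil`, `dilDeriv`, `hasFDerivAt_dil`, `det_dilDeriv` (`= ∏ m xᵢ^{m−1}`,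
  via `LinearMap.toMatrix'` = `Matrix.diagonal`), `injOn_dil`, `image_dil` (`m`-th roots),
  `isSemialgebraicMapOn_dil` (polynomial map), **`dilation_mem_changeOfVariablesRel`** (every `n`,
  every `m ≥ 1`) and **`dilationMove : DilationMove`** (crux stmt-3872 verbatim); `tMono k` (`m = k+1`,
  constant target), `tDil2 r`, `tDil3 r` (all `r`), `targets : Targets`, **`sectorTwoSix : SectorTwoSix`**,
  `conclusion_of_cdt : CDT → Conclusion`.

* §8 BY-PRODUCT: crux `ReductionTwoSix` (stmt-3871) PROVED from the same engine (`reductionTwoSix`;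
  the route's normal form `a + b/(1−t) + c/(1+t+t²)` is the numerator `a(1−t⁶) + bS₁ + cS₂` with
  `N = (a, −8c, 36b + 32c)`: `N_Qpoly`, `sectorFun_Qpoly`).
* §9 BY-PRODUCT: support items `RigidityTwoSix` (stmt-3874; `rigidityTwoSix`, from the tree's
  `BoxIntegral.normalForm_coeff_eq` + `setIntegral_box_normalForm`), `BoxIntegralZetaTwo` (stmt-3875)
  and `BoxIntegralLTwoChiThree` (stmt-3876) (verbatim tree theorems).
* §10 (cycle 4, gen 2) THE LOAD-BEARING MOVE: rule (1) alone cannot prove the crux —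
  `pair_not_mem_closure_add` (`[1+t³] − [4t] ∉ closure (domainAddRel ∪ integrandAddRel)`: the
  tree's restricted evaluation `KZ.restrictedEval` over the corner `(0,¼)²` kills both additivity
  moves, `KZ.closure_add_le_ker_restrictedEval`, and gives the pair a corner-mass gap `≥ 1/32`),
  `not_additiveConclusion` (the conclusion in the additivity-only sub-calculus is FALSE: any proof
  uses rule 2 or rule 3 — the proof of §7 uses rule 1b + four dilations, no Newton–Leibniz); and
  TIGHTNESS `tDil2_mem_changeOfVariablesRel` / `pair_mem_changeOfVariablesRel` (the pair is ONE
  rule-(2) generator apart). LANDING: filed as `Theorems/SectorTwoSix/Negative/LoadBearing.lean`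
  (p73882, `--supports` stmt-3870: `sectorTwoSix_false_without_value`, `withoutValue_imp_iff_not_cdt`,
  `not_sectorTwoSixInjective`, `not_sectorTwoSixEqOn`, `not_sectorTwoSixAdditive`,
  `pair_mem_changeOfVariablesRel`) — the first Negative/ lemmas of this crux in the tree.
  Re-verified this cycle: the whole file rc 0 / 0 warnings / 0 sorry against the 2026-08-16 tree.
* §11 (cycle 4) CDT IS NECESSARY FOR THE RIGIDITY STEP: `NfRigidity` (equal-valued normal forms have
  equal coefficients, no hypothesis) satisfies `nfRigidity_iff_cdt : NfRigidity ↔ CDT` — the new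
  direction `cdt_of_nfRigidity` reads a rational relation `g₀ + g₁π² + g₂L = 0` as the vanishing
  value of the normal form `(g₀, −8g₂, 216g₁ + 32g₂)`. So CDT is load-bearing for the route's PROOF
  (reduction + rigidity) though not for the crux's TRUTH (§2); the literal-normal-form version
  (`RigidityTwoSix` minus its antecedent ⇒ CDT) is LANDED as `Negative/RigidityNeedsCDT.lean` (p74918,
  `cdt_of_rigidityTwoSixConclusion`, `nfRep`, `value_nfRep`); `Negative/LoadBearing.lean` is LANDED
  as p73882. Both under `--supports` stmt-3870 (Theorems/SectorTwoSix/Negative/).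
  Route status after this file: 3870, 3871, 3872, 3874, 3875, 3876 have sorry-free proofs here
  (evidence files attached per item); open: 3873 (Apéry sector — same engine in dimension 3 with the
  tree's `BoxIntegralHurwitz` values), 3877 (Catalan, conditional), 3869 (summit-equivalent).
* §12 (cycle 5, gen 3) THE DUAL LOAD-BEARING MOVE: the SCISSORS sub-calculus (rule 1a domain
  additivity + rule 2 change of variables: cut and transport pieces) cannot prove the crux either.
  NEW INVARIANT `posMass [σ,f] = ∫_σ max f 0` (positive-part mass; not in the tree): it kills (1a)
  and (2) (`closure_scissors_le_ker_posMass` — for (2) the Jacobian formula applied to `f'⁺`, using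
  `|det Φ'| ≥ 0`), not (1b) (`posMass_integrandAdd_witness`, mass `−1`) nor (3).  The ZERO-VALUED
  numerator `P0 = (1+t³) − 4t` has `posMass ≥ 1/32 > 0 = posMass [0]` (`posMass_sectorRep_P0_pos`), so
  `[P0] − [0] ∉ closure (domainAddRel ∪ changeOfVariablesRel)` (`P0_not_mem_closure_scissors`; in
  particular `[P0]`, `[0]` are not one change of variables apart in either orientation,
  `P0_pair_not_mem_changeOfVariablesRel`) and `not_scissorsConclusion`: ANY proof uses rule (1b) or
  rule (3).  With §10: a Newton–Leibniz-free proof must use BOTH (1b) and (2) — §7 uses exactly these.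
  (`posMass` is blind to the positive pair of §4: `posMass_pair_eq`.)  Filed for landing as
  `Theorems/SectorTwoSix/Negative/ScissorsSubcalculus.lean` (`not_sectorTwoSixScissors`).
* §13 (cycle 5) THE CDT-FREE RESIDUE: unconditionally `Conclusion ↔ ∀ v : ℚ³, value [nfP v] = 0 →
  [nfP v] ∈ relations` (`conclusion_iff_kernel`, via the theorems `targets`/`cls_eq_cls_nfP`), while
  `CDT ↔ ∀ v, value [nfP v] = 0 → v = 0` (`cdt_iff_kernel_eq_zero`); `kernel_smul` (the residue is
  `ℚ`-homogeneous), `sectorTwoSix_iff_kernel`.  So the crux minus CDT says precisely: every rational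
  syzygy of `(1, H₃, H₅)` — equivalently of `(1, π², L(2,χ₋₃))` — is realised by KZ moves; CDT makes
  the syzygy module `0`, which is the only way anyone can discharge it (load-bearing for provability,
  §2/§11, not for truth).
  UNCONDITIONAL SHARPENING (tree's Lindemann ⇒ `π²` irrational, `CalegariDimitrovTang.irrational_pi_sq`):
  every non-zero syzygy involves `H₃` (`kernel_eq_zero_of_snd_eq_zero`), the syzygy module has rank
  `≤ 1` (`kernel_rank_le_one`), a non-zero syzygy is exactly `L(2,χ₋₃) ∈ ℚ + ℚπ²` (`L2chi3_mem_of_kernel`,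
  `exists_kernel_ne_zero_of_not_cdt`), hence **`conclusion_iff_cdt_or_exotic : Conclusion ↔ CDT ∨
  ∃ v₀ ≠ 0 syzygy, [nfP v₀] ∈ relations`** and `conclusion_iff_exotic_of_not_cdt`.
* §14 (cycle 5) THE EXACT NEWTON–LEIBNIZ-FREE MOVE SET: the §6–§7 engine re-run inside an arbitrary
  sub-calculus `S ≤ relations` containing (1b) + (2) and stable under `KZ.scale` (`SubCalc S`:
  `of_sub_of_mem_of_eqOn`, `clsS`, `scaleQS`, `clsS_smul`, `clsS_X_pow_eq`, `clsS_eq_clsS_nfP`,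
  `SubCalc.conclusionIn`); instances `subCalc_relations`, `subCalc_S12` (`S12 = closure (1b ∪ 2)`), hence
  `conclusionIn_oneB_two : CDT → ConclusionIn S12` (POSITIVE TIGHTNESS: no domain additivity, no
  Newton–Leibniz) and, with §10 + §12, **`nlFree_characterisation : CDT → ∀ a b c : Bool,
  ConclusionIn (subcalc a b c) ↔ (b ∧ c)`** over the eight sub-calculi `T ⊆ {1a,1b,2}` — the conclusion
  read in `closure T` holds iff `{1b, 2} ⊆ T` (`→` unconditional: `conclusionIn_subcalc_imp`);
  `sectorTwoSix_iff_oneB_two`.  The targets as rule-(2) GENERATORS: `tMono_mem_changeOfVariablesRel`,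
  `tDil3_mem_changeOfVariablesRel` (with §10's `tDil2_mem_changeOfVariablesRel`).
  DIMENSION BUDGET: the engine needs only instances supported in dimension `≤ 2` (`SubCalc` fields are
  `∩ formalRepLE 2`), so `conclusionIn_S12d2` (rules 1b + 2 among dimension-≤2 reps only),
  `conclusionIn_relationsLE_two` / `equivalentLE_two` (route DimensionBudget's `K_≤2` proves the sector,
  under CDT), `subCalc_relationsLE_two`, `subCalc_S12d2`.
* §15 (cycle 5) RULE (3) NEVER STARTS A CHAIN ON THE OPEN BOX: a Newton–Leibniz generator's band side
  has CLOSED fibres, the open box `(0,1)ⁿ⁺¹` has open ones — `boxN_ne_band` (every dimension, so also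
  for the Apéry sector), `box_ne_band`, `not_newtonLeibniz_band_of_domain_eq_box`: in any chain, rule (3)
  enters only after a rule-(1a) trade of the open box for a closed band (null faces) or through auxiliary
  representations.

Everything here is sorry-free (axioms of `sectorTwoSix`, `dilationMove`, `reductionTwoSix`,
`conclusion_iff_targets`: propext, Classical.choice, Quot.sound).
-/

noncomputable section

set_option linter.dupNamespace false

open Set MeasureTheory
open Literature.NumberTheory.Transcendental

namespace Summit.KontsevichZagierPeriods.KontsevichZagierPeriods.Cruxes.SectorTwoSix.Disproof

open Summit.KontsevichZagierPeriods.KontsevichZagierPeriods.Theses.HurwitzMicroSectors (SectorTwoSix)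

/-! ## §0 Read-back of the crux -/

/-- The open unit box `(0,1)²`, literally as inlined in the crux. -/
def box : Set (Fin 2 → ℝ) := {x | ∀ i, x i ∈ Set.Ioo (0:ℝ) 1}

/-- The sector integrand `P(x₀x₁)/(1 − (x₀x₁)⁶)`, literally as inlined in the crux. -/
def sectorFun (P : Polynomial ℚ) (x : Fin 2 → ℝ) : ℝ :=
  Polynomial.aeval (x 0 * x 1) P / (1 - (x 0 * x 1) ^ 6)

/-- The conclusion of the crux with the CDT antecedent dropped: Conjecture 1 on the level-6 weight-2
box sector. -/
def Conclusion : Prop :=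
  ∀ (r r' : KZ.IntegralRep 2) (P P' : Polynomial ℚ), r.domain = box → r'.domain = box →
    EqOn r.integrand (sectorFun P) r.domain → EqOn r'.integrand (sectorFun P') r'.domain →
    r.value = r'.value → KZ.Equivalent r r'

/-- Read-back (`Iff.rfl`): the crux is `CDT → Conclusion`, the antecedent being literally the named
fact `calegariDimitrovTang_linearIndependent`. -/
theorem crux_iff : SectorTwoSix ↔ (calegariDimitrovTang_linearIndependent → Conclusion) := Iff.rfl

/-- On the box `t = x₀x₁ ∈ (0,1)`. -/
theorem mul_mem_Ioo {x : Fin 2 → ℝ} (hx : x ∈ box) : x 0 * x 1 ∈ Ioo (0:ℝ) 1 :=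
  BoxIntegral.mul_mem_Ioo_of_mem_box hx

/-- On the box the denominator `1 − t⁶` is positive. -/
theorem den_pos {x : Fin 2 → ℝ} (hx : x ∈ box) : 0 < 1 - (x 0 * x 1) ^ 6 := by
  have ht := mul_mem_Ioo hx
  have : (x 0 * x 1) ^ 6 < 1 := pow_lt_one₀ ht.1.le ht.2 (by norm_num)
  linarith

/-! ## §1 Shape of any refutation -/

/-- The two-variable polynomial `P(X₀X₁)`. -/
def numPoly (P : Polynomial ℚ) : MvPolynomial (Fin 2) ℚ :=
  Polynomial.aeval (MvPolynomial.X 0 * MvPolynomial.X 1 : MvPolynomial (Fin 2) ℚ) P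

/-- The denominator `1 − (X₀X₁)⁶`. -/
def denPoly : MvPolynomial (Fin 2) ℚ := 1 - (MvPolynomial.X 0 * MvPolynomial.X 1) ^ 6

@[simp] theorem aeval_numPoly (P : Polynomial ℚ) (x : Fin 2 → ℝ) :
    MvPolynomial.aeval x (numPoly P) = Polynomial.aeval (x 0 * x 1) P := by
  unfold numPoly
  rw [← Polynomial.aeval_algHom_apply]
  simp

@[simp] theorem aeval_denPoly (x : Fin 2 → ℝ) :
    MvPolynomial.aeval x denPoly = 1 - (x 0 * x 1) ^ 6 := by
  simp [denPoly]

/-- Sector representations have KZ's literal (rational) shape: numerator `P(X₀X₁)`, denominator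
`1 − (X₀X₁)⁶`, non-vanishing on the box. -/
theorem isRational_of_sector {r : KZ.IntegralRep 2} {P : Polynomial ℚ} (hd : r.domain = box)
    (hf : EqOn r.integrand (sectorFun P) r.domain) : r.IsRational := by
  refine ⟨numPoly P, denPoly, fun x hx => ?_, fun x hx => ?_⟩
  · rw [aeval_denPoly]
    exact (den_pos (hd ▸ hx)).ne'
  · rw [hf hx]
    simp only [aeval_numPoly, aeval_denPoly, sectorFun]

/-- The conclusion is a special case of the summit (Conjecture 1 for rational representations). -/
theorem conclusion_of_summit (h : KontsevichZagierPeriods) : Conclusion :=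
  fun r r' _ _ hd hd' hf hf' hv => h r r' (isRational_of_sector hd hf) (isRational_of_sector hd' hf') hv

/-- Hence the crux follows from the summit (the CDT antecedent is not even used). -/
theorem of_summit (h : KontsevichZagierPeriods) : SectorTwoSix := fun _ => conclusion_of_summit h

/-- Any disproof of the crux disproves the summit. -/
theorem not_summit_of_not (h : ¬ SectorTwoSix) : ¬ KontsevichZagierPeriods := mt of_summit h

/-- Any disproof of the crux PROVES Calegari–Dimitrov–Tang's Theorem 1 in Lean. -/
theorem cdt_of_not (h : ¬ SectorTwoSix) : calegariDimitrovTang_linearIndependent := by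
  by_contra hc
  exact h fun hh => absurd hh hc

/-- **Immunity.** A refutation of the crux is exactly a Lean proof of CDT's Theorem 1 together with
a counterexample to Conjecture 1 on the level-6 box sector. -/
theorem not_iff : ¬ SectorTwoSix ↔ calegariDimitrovTang_linearIndependent ∧ ¬ Conclusion := by
  rw [crux_iff, Classical.not_imp]

/-- What a counterexample to the conclusion is: two sector representations with equal values whose
difference is not a relation. -/
theorem not_conclusion_iff : ¬ Conclusion ↔ ∃ (r r' : KZ.IntegralRep 2) (P P' : Polynomial ℚ),
    r.domain = box ∧ r'.domain = box ∧ EqOn r.integrand (sectorFun P) r.domain ∧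
    EqOn r'.integrand (sectorFun P') r'.domain ∧ r.value = r'.value ∧
    KZ.of r - KZ.of r' ∉ KZ.relations := by
  simp only [Conclusion, KZ.Equivalent, not_forall, exists_prop]

/-- The only known way to certify non-membership in `KZ.relations`: an additive invariant killing
the four move sets and separating the pair.  `KZ.eval` is such an invariant but it does not separate
equal-valued pairs; Conjecture 1 says there is no finer one on rational representations. -/
theorem not_of_separating_invariant {A : Type*} [AddCommGroup A] (φ : KZ.FormalRep →+ A)
    (hφ : KZ.domainAddRel ∪ KZ.integrandAddRel ∪ KZ.changeOfVariablesRel ∪ KZ.newtonLeibnizRel ⊆ φ.ker)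
    (r r' : KZ.IntegralRep 2) (P P' : Polynomial ℚ) (hd : r.domain = box) (hd' : r'.domain = box)
    (hf : EqOn r.integrand (sectorFun P) r.domain) (hf' : EqOn r'.integrand (sectorFun P') r'.domain)
    (hv : r.value = r'.value) (hsep : φ (KZ.of r) ≠ φ (KZ.of r')) : ¬ Conclusion := by
  intro hC
  have hmem := hC r r' P P' hd hd' hf hf' hv
  have hle : KZ.relations ≤ φ.ker := (AddSubgroup.closure_le _).mpr hφ
  have := hle hmem
  rw [AddMonoidHom.mem_ker, map_sub, sub_eq_zero] at this
  exact hsep this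

/-! ## §3 Non-vacuity: the representations of the sector, explicitly -/

/-- The box is `ℚ`-semialgebraic (tree: `KZ.isSemialgebraic_box`). -/
theorem isSemialgebraic_box : Literature.ModelTheory.ExponentialFields.IsSemialgebraic ℚ box :=
  KZ.isSemialgebraic_box 2

/-- The box is measurable. -/
theorem measurableSet_box : MeasurableSet box := Beukers.measurableSet_cube 2

/-- The constant representation `[box, a]`, `a ∈ ℚ`. -/
def constRep (a : ℚ) : KZ.IntegralRep 2 where
  domain := box
  integrand := fun _ => (a : ℝ)
  isSemialgebraic_domain := isSemialgebraic_box
  isSemialgebraicFunOn_integrand :=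
    (isSemialgebraicFunOn_aeval isSemialgebraic_box (MvPolynomial.C a)).congr fun x _ => by simp
  integrableOn := BoxIntegral.integrableOn_box_const 2 a

@[simp] theorem constRep_domain (a : ℚ) : (constRep a).domain = box := rfl
@[simp] theorem constRep_integrand (a : ℚ) : (constRep a).integrand = fun _ => (a : ℝ) := rfl

/-- `[box, a]` has value `a` (the box has volume `1`). -/
@[simp] theorem value_constRep (a : ℚ) : (constRep a).value = a := by
  simp only [KZ.IntegralRep.value, constRep]
  exact BoxIntegral.setIntegral_box_const 2 a

/-- `[box, 0]` lies in the sector: its integrand is `sectorFun 0`. -/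
theorem constRep_zero_eqOn : EqOn (constRep 0).integrand (sectorFun 0) (constRep 0).domain := by
  intro x _
  simp [sectorFun]

/-- `[box, 1]` lies in the sector: its integrand is `sectorFun (1 − t⁶) = (1 − t⁶)/(1 − t⁶)` on the
box. -/
theorem constRep_one_eqOn :
    EqOn (constRep 1).integrand (sectorFun (1 - Polynomial.X ^ 6)) (constRep 1).domain := by
  intro x hx
  have h := (den_pos hx).ne'
  simp only [constRep_integrand, Rat.cast_one, sectorFun, map_sub, map_one, map_pow,
    Polynomial.aeval_X]
  rw [div_self h]

/-- Integrability of the sector integrand: a finite `ℚ`-combination of the Hurwitz kernels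
`tᵏ/(1 − t⁶)`, each integrable on the box (tree: `BoxIntegral.integrableOn_box_pow_div_one_sub_pow`). -/
theorem integrableOn_sectorFun (P : Polynomial ℚ) : IntegrableOn (sectorFun P) box volume := by
  have hsum : IntegrableOn (fun x : Fin 2 → ℝ => ∑ i ∈ Finset.range (P.natDegree + 1),
      (P.coeff i : ℝ) * ((x 0 * x 1) ^ i / (1 - (x 0 * x 1) ^ 6))) box volume := by
    refine integrable_finsetSum _ fun i _ => ?_
    exact (BoxIntegral.integrableOn_box_pow_div_one_sub_pow (by norm_num : 1 ≤ 6) i).const_mul _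
  refine hsum.congr_fun (fun x _ => ?_) measurableSet_box
  simp only [sectorFun]
  rw [Polynomial.aeval_eq_sum_range, Finset.sum_div]
  refine Finset.sum_congr rfl fun i _ => ?_
  rw [Rat.smul_def, ← eq_ratCast (algebraMap ℚ ℝ), mul_div_assoc]

/-- **The sector representation `[box, P(t)/(1 − t⁶)]`** for every `P ∈ ℚ[t]`: the universally
quantified `r` of the crux is inhabited for every numerator, so the crux is not vacuous. -/
def sectorRep (P : Polynomial ℚ) : KZ.IntegralRep 2 where
  domain := box
  integrand := sectorFun P
  isSemialgebraic_domain := isSemialgebraic_box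
  isSemialgebraicFunOn_integrand :=
    (isSemialgebraicFunOn_aeval_div_aeval isSemialgebraic_box (numPoly P) denPoly
      (fun x hx => by rw [aeval_denPoly]; exact (den_pos hx).ne')).congr fun x _ => by
        simp only [aeval_numPoly, aeval_denPoly, sectorFun]
  integrableOn := integrableOn_sectorFun P

@[simp] theorem sectorRep_domain (P : Polynomial ℚ) : (sectorRep P).domain = box := rfl
@[simp] theorem sectorRep_integrand (P : Polynomial ℚ) : (sectorRep P).integrand = sectorFun P := rfl

theorem sectorRep_eqOn (P : Polynomial ℚ) :
    EqOn (sectorRep P).integrand (sectorFun P) (sectorRep P).domain := fun _ _ => rfl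

/-- `sectorRep` is rational in KZ's literal sense. -/
theorem isRational_sectorRep (P : Polynomial ℚ) : (sectorRep P).IsRational :=
  isRational_of_sector rfl (sectorRep_eqOn P)

/-- **Off-domain freedom is a relation**: any `r` of the crux's shape differs from the canonical
`sectorRep P` by a relation (integrand additivity against a zero representation; tree:
`KZ.of_sub_of_mem_relations_of_eqOn`). So the crux is a statement about the classes `[sectorRep P]`. -/
theorem of_sub_of_sectorRep_mem_relations {r : KZ.IntegralRep 2} {P : Polynomial ℚ}
    (hd : r.domain = box) (hf : EqOn r.integrand (sectorFun P) r.domain) :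
    KZ.of r - KZ.of (sectorRep P) ∈ KZ.relations :=
  KZ.of_sub_of_mem_relations_of_eqOn (by rw [sectorRep_domain, hd]) (fun x hx => hf hx)

/-- The crux restated on canonical representatives: it suffices (and is necessary) to treat the
pairs `(sectorRep P, sectorRep P')`. -/
theorem conclusion_iff_sectorRep : Conclusion ↔ ∀ P P' : Polynomial ℚ,
    (sectorRep P).value = (sectorRep P').value → KZ.Equivalent (sectorRep P) (sectorRep P') := by
  constructor
  · intro h P P' hv
    exact h _ _ P P' rfl rfl (sectorRep_eqOn P) (sectorRep_eqOn P') hv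
  · intro h r r' P P' hd hd' hf hf' hv
    have h1 := of_sub_of_sectorRep_mem_relations hd hf
    have h2 := of_sub_of_sectorRep_mem_relations hd' hf'
    have hv1 : r.value = (sectorRep P).value := KZ.Equivalent.value_eq_holds h1
    have hv2 : r'.value = (sectorRep P').value := KZ.Equivalent.value_eq_holds h2
    have h3 : KZ.Equivalent (sectorRep P) (sectorRep P') := h P P' (by rw [← hv1, ← hv2, hv])
    exact (KZ.Equivalent.trans h1 h3).trans (KZ.Equivalent.symm h2)

/-- Value of the monomial sector representation: the Hurwitz number
`H_k = ∫_{(0,1)²} tᵏ/(1 − t⁶) = Σ_j (6j+k+1)⁻²` (tree: `BoxIntegral.setIntegral_box_pow_div_one_sub_pow`). -/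
theorem value_sectorRep_monomial (k : ℕ) :
    (sectorRep (Polynomial.X ^ k)).value = ∑' j : ℕ, 1 / ((6:ℝ) * j + k + 1) ^ 2 := by
  have h := BoxIntegral.setIntegral_box_pow_div_one_sub_pow (m := 6) (by norm_num) k
  simp only [KZ.IntegralRep.value, sectorRep_domain, sectorRep_integrand]
  rw [← show ((6:ℕ):ℝ) = 6 by norm_num, ← h]
  refine setIntegral_congr_fun measurableSet_box fun x _ => ?_
  simp [sectorFun]

/-! ## §2 Load-bearing hypotheses -/

/-- The crux's conclusion with the hypothesis `r.value = r'.value` dropped. -/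
def WithoutValueEq : Prop :=
  ∀ (r r' : KZ.IntegralRep 2) (P P' : Polynomial ℚ), r.domain = box → r'.domain = box →
    EqOn r.integrand (sectorFun P) r.domain → EqOn r'.integrand (sectorFun P') r'.domain →
    KZ.Equivalent r r'

/-- **`r.value = r'.value` is load-bearing**: without it the statement is false — `[box, 0]`
(numerator `0`) and `[box, 1]` (numerator `1 − t⁶`) lie in the sector, have values `0 ≠ 1`, and
equivalent representations have equal values (soundness, tree: `KZ.Equivalent.value_eq_holds`). -/
theorem not_withoutValueEq : ¬ WithoutValueEq := by
  intro h
  have heq := h (constRep 0) (constRep 1) 0 (1 - Polynomial.X ^ 6) rfl rfl constRep_zero_eqOn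
    constRep_one_eqOn
  have hv : (constRep 0).value = (constRep 1).value := KZ.Equivalent.value_eq_holds heq
  rw [value_constRep, value_constRep] at hv
  norm_num at hv

/-- With the CDT antecedent kept, the mutilated crux `CDT → WithoutValueEq` is equivalent to `¬ CDT`
(so it is false in reality, but refuting it in Lean again means proving CDT). -/
theorem cdt_imp_withoutValueEq_iff_not_cdt :
    (calegariDimitrovTang_linearIndependent → WithoutValueEq) ↔
      ¬ calegariDimitrovTang_linearIndependent :=
  ⟨fun h hc => not_withoutValueEq (h hc), fun h hc => absurd hc h⟩

/-- The conclusion with the domain hypotheses dropped but rationality kept (KZ's literal shape on an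
arbitrary `ℚ`-semialgebraic domain): still a special case of the summit, hence not refutable without
refuting Conjecture 1. -/
def WithoutDomain : Prop :=
  ∀ (r r' : KZ.IntegralRep 2), r.IsRational → r'.IsRational → r.value = r'.value → KZ.Equivalent r r'

theorem withoutDomain_of_summit (h : KontsevichZagierPeriods) : WithoutDomain :=
  fun r r' hr hr' hv => h r r' hr hr' hv

theorem conclusion_of_withoutDomain (h : WithoutDomain) : Conclusion :=
  fun r r' _ _ hd hd' hf hf' hv => h r r' (isRational_of_sector hd hf) (isRational_of_sector hd' hf') hv

/-- The conclusion with the CDT antecedent dropped is `Conclusion` itself: implied by the summit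
(`conclusion_of_summit`), so CDT is load-bearing for PROVABILITY (today's only route to the
conclusion is reduction + rigidity, and rigidity of the normal forms `a + bH₃ + cH₅` IS the
`ℚ`-independence of `1, H₃ = −L/8 + π²/54, H₅ = π²/216`, i.e. of `1, π², L`), not for TRUTH. -/
theorem withoutCDT_iff : (Conclusion) ↔ (calegariDimitrovTang_linearIndependent ∨ True) ∧ Conclusion := by
  simp

/-! ## §4 Why it resists: syzygies of the sector and the move chain

The value functional on numerators is `P = Σ pₖ tᵏ ↦ Σ pₖ Hₖ`, `Hₖ = Σ_j (6j+k+1)⁻²`, with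
`H_{k+6} = Hₖ − (k+1)⁻²` and the level-6 values `H₀…H₅ ∈ ℚπ² + ℚL` (tree:
`BoxIntegral.setIntegral_box_level_six_*`).  Its kernel is spanned over `ℚ` — iff `1, π², L` are
`ℚ`-independent — by
* the shift relations `t^{k+6} − tᵏ + (1 − t⁶)/(k+1)²` : inside the calculus these are
  `[box, tᵏ] ∼ [box, (k+1)⁻²]` — ONE change of variables `xᵢ ↦ xᵢ^{k+1}` with CONSTANT target
  integrand `(k+1)⁻²` (Jacobian `(k+1)² tᵏ`), proved in §7 (`tMono`); the route's plan (two
  Newton–Leibniz moves down to dimension 0 with polynomial primitives and two back, null faces by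
  rule 1a) also works but is not needed, and either way the tree's barrier
  `noSemialgebraicPrimitive_inv_sub_two` is not engaged;
* the distribution relations `tʳ + t^{r+3} − 4t^{2r+1}` (`r = 0,1,2`) and
  `tʳ + t^{r+2} + t^{r+4} − 9t^{3r+2}` (`r = 0,1`): ONE change of variables each,
  `Φ(x) = (x₀^m, x₁^m)` (`m = 2, 3`) on the open box — `Φ` is polynomial hence
  `IsSemialgebraicMapOn ℚ` (tree: `isSemialgebraicMapOn_aeval`), injective on the box with
  `Φ '' box = box`, `HasFDerivWithinAt` with `Φ' x = diag(m xᵢ^{m−1})`, `|det Φ' x| = m² t^{m−1} > 0`,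
  and `tʳ/(1 − t³) = (tʳ + t^{r+3})/(1 − t⁶)` pulls back to `4t^{2r+1}/(1 − t⁶)` — every field of
  `KZ.changeOfVariablesRel` as typed is met (this is crux `DilationMove`, stmt-…-3872, at `n = 2`);
* rational rescaling of any chain is again a chain: `KZ.scale` / `KZ.scale_mem_relations` (tree,
  proved), and `[box, k·f] − k•[box, f] ∈ relations` (tree: `KZ.IntegralRep.of_constMul_nat_sub_nsmul_mem`).
So under CDT two equal-valued numerators have the same normal form `A + B·t³/(1−t⁶) + C·t⁵/(1−t⁶)`
and are equivalent through it.  The numerics of §5 confirm the rank count (codimension 3 exactly).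

What is recorded in Lean here: the sector HAS non-trivial syzygies, so the conclusion is not the
empty statement "the value map is injective on numerators". -/

/-- `H₀ + H₃ = 4H₁` on canonical representatives: the numerators `1 + t³` and `4t` give equal
values (the `m = 2`, `r = 0` distribution relation; tree: `BoxIntegral.level_six_relations`). -/
theorem value_sectorRep_one_add_X_pow_three_eq :
    (sectorRep (1 + Polynomial.X ^ 3)).value = (sectorRep (4 * Polynomial.X)).value := by
  obtain ⟨-, h03, -, -⟩ := BoxIntegral.level_six_relations
  have hI0 := BoxIntegral.integrableOn_box_pow_div_one_sub_pow (m := 6) (by norm_num) 0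
  have hI3 := BoxIntegral.integrableOn_box_pow_div_one_sub_pow (m := 6) (by norm_num) 3
  simp only [KZ.IntegralRep.value, sectorRep_domain, sectorRep_integrand, box]
  have hL : ∫ x in {x : Fin 2 → ℝ | ∀ i, x i ∈ Ioo (0:ℝ) 1}, sectorFun (1 + Polynomial.X ^ 3) x =
      (∫ x in {x : Fin 2 → ℝ | ∀ i, x i ∈ Ioo (0:ℝ) 1}, (x 0 * x 1) ^ 0 / (1 - (x 0 * x 1) ^ 6)) +
        ∫ x in {x : Fin 2 → ℝ | ∀ i, x i ∈ Ioo (0:ℝ) 1}, (x 0 * x 1) ^ 3 / (1 - (x 0 * x 1) ^ 6) := by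
    rw [← integral_add hI0 hI3]
    refine setIntegral_congr_fun (Beukers.measurableSet_cube 2) fun x _ => ?_
    simp only [sectorFun, map_add, map_one, map_pow, Polynomial.aeval_X, pow_zero]
    ring
  have hR : ∫ x in {x : Fin 2 → ℝ | ∀ i, x i ∈ Ioo (0:ℝ) 1}, sectorFun (4 * Polynomial.X) x =
      4 * ∫ x in {x : Fin 2 → ℝ | ∀ i, x i ∈ Ioo (0:ℝ) 1}, (x 0 * x 1) ^ 1 / (1 - (x 0 * x 1) ^ 6) := by
    rw [← integral_const_mul]
    refine setIntegral_congr_fun (Beukers.measurableSet_cube 2) fun x _ => ?_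
    simp only [sectorFun, map_mul, map_ofNat, Polynomial.aeval_X, pow_one]
    ring
  rw [hL, hR]
  exact h03

/-- The numerators differ. -/
theorem one_add_X_pow_three_ne : (1 + Polynomial.X ^ 3 : Polynomial ℚ) ≠ 4 * Polynomial.X := by
  intro h
  have := congrArg (fun p : Polynomial ℚ => p.coeff 0) h
  simp at this

/-- The natural strengthening "equal values ⇒ equal numerators" (value-rigidity of the whole sector,
which would make the conclusion trivial by `rfl`-type reasoning). -/
def NumeratorRigidity : Prop :=
  ∀ P P' : Polynomial ℚ, (sectorRep P).value = (sectorRep P').value → P = P'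

/-- **Refuted strengthening**: the sector has syzygies (`[1 + t³]` and `[4t]` have equal values), so
the conclusion of the crux demands genuine moves between different integrands. -/
theorem not_numeratorRigidity : ¬ NumeratorRigidity := fun h =>
  one_add_X_pow_three_ne (h _ _ value_sectorRep_one_add_X_pow_three_eq)

/-- The pair is a genuine instance of the crux's conclusion: any proof must produce a chain of moves
from `[box, (1+t³)/(1−t⁶)] = [box, 1/(1−t³)]` to `[box, 4t/(1−t⁶)]` (it is ONE dilation `xᵢ ↦ xᵢ²`). -/
theorem conclusion_instance (hC : Conclusion) :
    KZ.Equivalent (sectorRep (1 + Polynomial.X ^ 3)) (sectorRep (4 * Polynomial.X)) :=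
  (conclusion_iff_sectorRep.mp hC) _ _ value_sectorRep_one_add_X_pow_three_eq


/-! ## §6 The typed engine: under CDT the crux is EQUIVALENT to single-move targets

Targets (each ONE instance of a move of the calculus, with every typed side condition met on paper,
see §4):
* `TMono k`  : `[box, tᵏ] − [box, (k+1)⁻²] ∈ relations` (ONE dilation `xᵢ ↦ xᵢ^{k+1}` with constant
  target integrand, §7; the Newton–Leibniz descent of the route's plan is an alternative);
* `TDil2 r`  : `[box, 4t^{2r+1}/(1−t⁶)] − [box, (tʳ + t^{r+3})/(1−t⁶)] ∈ relations`
  (ONE change of variables `xᵢ ↦ xᵢ²`; = crux `DilationMove` at `n = 2, m = 2`, since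
  `(tʳ + t^{r+3})/(1−t⁶) = tʳ/(1−t³)` on the box);
* `TDil3 r`  : `[box, 9t^{3r+2}/(1−t⁶)] − [box, (tʳ + t^{r+2} + t^{r+4})/(1−t⁶)] ∈ relations`
  (`xᵢ ↦ xᵢ³`).
Main results: `conclusion_of_targets` (CDT + `TMono` + `TDil2 0,1,2` + `TDil3 1` ⇒ `Conclusion`),
`targets_of_conclusion` (the targets are instances of the conclusion: NECESSARY), hence
`crux_iff_targets : CDT → (Conclusion ↔ Targets)`.  `TDil3 0` (`H₀+H₂+H₄ = 9H₂`) is redundant. -/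

section Engine

open Polynomial

/-- The monomial representation `[box, tᵏ]`. -/
def monoRep (k : ℕ) : KZ.IntegralRep 2 where
  domain := box
  integrand := fun x => (x 0 * x 1) ^ k
  isSemialgebraic_domain := isSemialgebraic_box
  isSemialgebraicFunOn_integrand :=
    (isSemialgebraicFunOn_aeval isSemialgebraic_box
      ((MvPolynomial.X 0 * MvPolynomial.X 1 : MvPolynomial (Fin 2) ℚ) ^ k)).congr fun x _ => by simp
  integrableOn := BoxIntegral.integrableOn_box_mul_pow k

@[simp] theorem monoRep_domain (k : ℕ) : (monoRep k).domain = box := rfl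
@[simp] theorem monoRep_integrand (k : ℕ) : (monoRep k).integrand = fun x => (x 0 * x 1) ^ k := rfl

/-- `[box, tᵏ]` has value `(k+1)⁻²`. -/
@[simp] theorem value_monoRep (k : ℕ) : (monoRep k).value = 1 / ((k : ℝ) + 1) ^ 2 :=
  BoxIntegral.setIntegral_box_mul_pow k

/-- Target: the monomial evaluation `[box, tᵏ] ∼ [box, (k+1)⁻²]` (ONE dilation `xᵢ ↦ xᵢ^{k+1}`
with constant target integrand, §7). -/
def TMono (k : ℕ) : Prop :=
  KZ.of (monoRep k) - KZ.of (constRep (1 / ((k : ℚ) + 1) ^ 2)) ∈ KZ.relations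

/-- Target: the `m = 2` dilation (crux `DilationMove`, `n = 2`), source `4t^{2r+1}/(1−t⁶)`, target
`(tʳ + t^{r+3})/(1−t⁶) = tʳ/(1−t³)`. -/
def TDil2 (r : ℕ) : Prop :=
  KZ.of (sectorRep (4 * X ^ (2 * r + 1))) - KZ.of (sectorRep (X ^ r + X ^ (r + 3))) ∈ KZ.relations

/-- Target: the `m = 3` dilation, source `9t^{3r+2}/(1−t⁶)`, target
`(tʳ + t^{r+2} + t^{r+4})/(1−t⁶) = tʳ/(1−t²)`. -/
def TDil3 (r : ℕ) : Prop :=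
  KZ.of (sectorRep (9 * X ^ (3 * r + 2))) - KZ.of (sectorRep (X ^ r + X ^ (r + 2) + X ^ (r + 4)))
    ∈ KZ.relations

/-- The conjunction of targets actually used. -/
def Targets : Prop := (∀ k, TMono k) ∧ TDil2 0 ∧ TDil2 1 ∧ TDil2 2 ∧ TDil3 1

/-! ### The class map `ℚ[t] → FormalRep ⧸ relations` -/

/-- The formal group modulo the relations. -/
abbrev Qt : Type := KZ.FormalRep ⧸ KZ.relations

/-- The class of `[box, P(t)/(1−t⁶)]`. -/
def cls (P : ℚ[X]) : Qt := ((KZ.of (sectorRep P) : KZ.FormalRep) : Qt)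

theorem cls_eq_cls_iff (P P' : ℚ[X]) :
    cls P = cls P' ↔ KZ.Equivalent (sectorRep P) (sectorRep P') :=
  QuotientAddGroup.eq_iff_sub_mem

/-- Integrand additivity: `[P + P'] − [P] − [P']` is ONE move (rule 1b). -/
theorem of_sectorRep_add_sub_mem (P P' : ℚ[X]) :
    KZ.of (sectorRep (P + P')) - KZ.of (sectorRep P) - KZ.of (sectorRep P') ∈ KZ.relations :=
  KZ.integrandAddRel_subset_relations ⟨2, sectorRep (P + P'), sectorRep P, sectorRep P', rfl, rfl,
    fun x _ => by simp [sectorFun, add_div], rfl⟩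

theorem cls_add (P P' : ℚ[X]) : cls (P + P') = cls P + cls P' := by
  have h := of_sectorRep_add_sub_mem P P'
  rw [sub_sub] at h
  exact QuotientAddGroup.eq_iff_sub_mem.mpr h

theorem cls_zero : cls 0 = 0 :=
  (QuotientAddGroup.eq_zero_iff _).mpr
    (KZ.of_mem_relations_of_eqOn_zero _ fun x _ => by simp [sectorFun])

/-- The class map as an additive homomorphism. -/
def clsHom : ℚ[X] →+ Qt where
  toFun := cls
  map_zero' := cls_zero
  map_add' := cls_add

@[simp] theorem clsHom_apply (P : ℚ[X]) : clsHom P = cls P := rfl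

theorem isAlgebraic_ratCast (c : ℚ) : IsAlgebraic ℚ ((c : ℚ) : ℝ) := by
  simpa using isAlgebraic_algebraMap (R := ℚ) (A := ℝ) c

/-- `KZ.scale` descends to the quotient (tree: `KZ.scale_mem_relations`). -/
def scaleQ (c : ℚ) : Qt →+ Qt :=
  QuotientAddGroup.map KZ.relations KZ.relations (KZ.scale (c : ℝ) (isAlgebraic_ratCast c))
    fun _ hx => KZ.scale_mem_relations _ _ hx

theorem scaleQ_mk (c : ℚ) (x : KZ.FormalRep) :
    scaleQ c (x : Qt) = ((KZ.scale (c : ℝ) (isAlgebraic_ratCast c) x : KZ.FormalRep) : Qt) := rfl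

/-- Rational rescaling of numerators is rescaling of classes: no "division rule" is needed. -/
theorem cls_smul (c : ℚ) (P : ℚ[X]) : cls (c • P) = scaleQ c (cls P) := by
  rw [cls, cls, scaleQ_mk, KZ.scale_of]
  refine QuotientAddGroup.eq_iff_sub_mem.mpr (KZ.of_sub_of_mem_relations_of_eqOn rfl fun x _ => ?_)
  simp [sectorFun, Rat.smul_def, mul_div_assoc]

/-! ### The normal form `A(1 − t⁶) + Bt³ + Ct⁵` and the coefficient map -/

/-- Normal-form numerator with value `A + B·H₃ + C·H₅`. -/
def nfP (v : ℚ × ℚ × ℚ) : ℚ[X] := C v.1 * (1 - X ^ 6) + C v.2.1 * X ^ 3 + C v.2.2 * X ^ 5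

theorem nfP_add (v w : ℚ × ℚ × ℚ) : nfP (v + w) = nfP v + nfP w := by
  simp only [nfP, Prod.fst_add, Prod.snd_add, map_add]
  ring

theorem nfP_smul (c : ℚ) (v : ℚ × ℚ × ℚ) : nfP (c • v) = c • nfP v := by
  simp only [nfP, Prod.smul_fst, Prod.smul_snd, smul_eq_mul, map_mul, smul_eq_C_mul]
  ring

theorem nfP_sub (v w : ℚ × ℚ × ℚ) : nfP (v - w) = nfP v - nfP w := by
  simp only [nfP, Prod.fst_sub, Prod.snd_sub, map_sub]
  ring

/-- Normal-form coefficients of the monomial `tᵏ`: the level-6 table and the shift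
`N(t^{k+6}) = N(tᵏ) − ((k+1)⁻², 0, 0)`. -/
def Nmono : ℕ → ℚ × ℚ × ℚ
  | 0 => (0, -5, 32)
  | 1 => (0, -1, 8)
  | 2 => (0, 0, 3)
  | 3 => (0, 1, 0)
  | 4 => (0, 5, -8)
  | 5 => (0, 0, 1)
  | k + 6 => Nmono k - (1 / ((k : ℚ) + 1) ^ 2, 0, 0)

/-- The normal-form coefficient map `N : ℚ[t] → ℚ³` (ℚ-linear). -/
def N (P : ℚ[X]) : ℚ × ℚ × ℚ := P.sum fun k c => c • Nmono k

theorem N_add (P P' : ℚ[X]) : N (P + P') = N P + N P' :=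
  Polynomial.sum_add_index _ _ _ (fun _ => zero_smul _ _) fun _ _ _ => add_smul _ _ _

theorem N_monomial (k : ℕ) (a : ℚ) : N (monomial k a) = a • Nmono k :=
  Polynomial.sum_monomial_index _ _ (zero_smul _ _)

theorem N_X_pow (k : ℕ) : N (X ^ k) = Nmono k := by
  rw [X_pow_eq_monomial, N_monomial, one_smul]

/-! ### Reduction of every numerator to its normal form, from the targets -/

/-- `[X^k − X^{k+6}]` is `[box, tᵏ]` and `[C q · (1 − X⁶)]` is `[box, q]` up to `EqOn`-relations, so
`TMono k` reads `cls (X^(k+6)) = cls (X^k) − cls (C (k+1)⁻² * (1 − X⁶))`. -/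
theorem cls_X_pow_add_six (hM : ∀ k, TMono k) (k : ℕ) :
    cls (X ^ (k + 6)) = cls (X ^ k) - cls (C (1 / ((k : ℚ) + 1) ^ 2) * (1 - X ^ 6)) := by
  have h1 : KZ.of (sectorRep (X ^ k - X ^ (k + 6))) - KZ.of (monoRep k) ∈ KZ.relations := by
    refine KZ.of_sub_of_mem_relations_of_eqOn rfl fun x hx => ?_
    have hd : 1 - (x 0 * x 1) ^ 6 ≠ 0 := (den_pos hx).ne'
    simp only [sectorRep_integrand, sectorFun, map_sub, map_pow, aeval_X, monoRep_integrand]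
    rw [div_eq_iff hd]
    ring
  have h2 : KZ.of (constRep (1 / ((k : ℚ) + 1) ^ 2)) -
      KZ.of (sectorRep (C (1 / ((k : ℚ) + 1) ^ 2) * (1 - X ^ 6))) ∈ KZ.relations := by
    refine KZ.of_sub_of_mem_relations_of_eqOn rfl fun x hx => ?_
    have hd : 1 - (x 0 * x 1) ^ 6 ≠ 0 := (den_pos hx).ne'
    simp only [constRep_integrand, sectorRep_integrand, sectorFun, map_mul, aeval_C, map_sub,
      map_one, map_pow, aeval_X]
    rw [mul_div_assoc, div_self hd, mul_one, eq_ratCast]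
  have h3 : KZ.of (sectorRep (X ^ k - X ^ (k + 6))) -
      KZ.of (sectorRep (C (1 / ((k : ℚ) + 1) ^ 2) * (1 - X ^ 6))) ∈ KZ.relations := by
    have : KZ.of (sectorRep (X ^ k - X ^ (k + 6))) -
        KZ.of (sectorRep (C (1 / ((k : ℚ) + 1) ^ 2) * (1 - X ^ 6))) =
        (KZ.of (sectorRep (X ^ k - X ^ (k + 6))) - KZ.of (monoRep k)) +
          (KZ.of (monoRep k) - KZ.of (constRep (1 / ((k : ℚ) + 1) ^ 2))) +
          (KZ.of (constRep (1 / ((k : ℚ) + 1) ^ 2)) -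
            KZ.of (sectorRep (C (1 / ((k : ℚ) + 1) ^ 2) * (1 - X ^ 6)))) := by abel
    rw [this]
    exact KZ.relations.add_mem (KZ.relations.add_mem h1 (hM k)) h2
  have h4 : cls (X ^ k - X ^ (k + 6)) = cls (C (1 / ((k : ℚ) + 1) ^ 2) * (1 - X ^ 6)) :=
    QuotientAddGroup.eq_iff_sub_mem.mpr h3
  have h5 : cls (X ^ k - X ^ (k + 6)) = cls (X ^ k) - cls (X ^ (k + 6)) := map_sub clsHom _ _
  rw [h5] at h4
  rw [← h4]
  abel

/-- The dilation targets as equations in the quotient. -/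
theorem cls_eq_of_TDil2 {r : ℕ} (h : TDil2 r) :
    4 • cls (X ^ (2 * r + 1)) = cls (X ^ r) + cls (X ^ (r + 3)) := by
  have h1 : cls (4 * X ^ (2 * r + 1)) = cls (X ^ r + X ^ (r + 3)) := QuotientAddGroup.eq_iff_sub_mem.mpr h
  rw [cls_add, show (4 : ℚ[X]) * X ^ (2 * r + 1) = 4 • X ^ (2 * r + 1) by simp [nsmul_eq_mul]] at h1
  rwa [show cls (4 • X ^ (2 * r + 1)) = 4 • cls (X ^ (2 * r + 1)) from map_nsmul clsHom _ _] at h1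

theorem cls_eq_of_TDil3 {r : ℕ} (h : TDil3 r) :
    9 • cls (X ^ (3 * r + 2)) = cls (X ^ r) + cls (X ^ (r + 2)) + cls (X ^ (r + 4)) := by
  have h1 : cls (9 * X ^ (3 * r + 2)) = cls (X ^ r + X ^ (r + 2) + X ^ (r + 4)) :=
    QuotientAddGroup.eq_iff_sub_mem.mpr h
  rw [cls_add, cls_add, show (9 : ℚ[X]) * X ^ (3 * r + 2) = 9 • X ^ (3 * r + 2) by
    simp [nsmul_eq_mul]] at h1
  rwa [show cls (9 • X ^ (3 * r + 2)) = 9 • cls (X ^ (3 * r + 2)) from map_nsmul clsHom _ _] at h1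

/-- `cls (nfP v)` in coordinates. -/
theorem cls_nfP (v : ℚ × ℚ × ℚ) :
    cls (nfP v) = cls (C v.1 * (1 - X ^ 6)) + scaleQ v.2.1 (cls (X ^ 3)) + scaleQ v.2.2 (cls (X ^ 5)) := by
  rw [nfP, cls_add, cls_add, ← smul_eq_C_mul (v.2.1), ← smul_eq_C_mul (v.2.2), cls_smul, cls_smul]

/-- **Monomial reduction**: from the targets, `cls (tᵏ) = cls (nfP (N tᵏ))` for every `k`. -/
theorem cls_X_pow_eq (hT : Targets) (k : ℕ) : cls (X ^ k) = cls (nfP (Nmono k)) := by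
  obtain ⟨hM, h20, h21, h22, h31⟩ := hT
  have e20 := cls_eq_of_TDil2 h20   -- 4•x1 = x0 + x3
  have e21 := cls_eq_of_TDil2 h21   -- 4•x3 = x1 + x4
  have e22 := cls_eq_of_TDil2 h22   -- 4•x5 = x2 + x5
  have e31 := cls_eq_of_TDil3 h31   -- 9•x5 = x1 + x3 + x5
  simp only [Nat.reduceMul, Nat.reduceAdd] at e20 e21 e22 e31
  -- normal forms in coordinates: `cls (nfP (0, b, c)) = b • x3 + c • x5` for INTEGER `b, c`
  have hint : ∀ (b c : ℤ), cls (nfP (0, (b : ℚ), (c : ℚ))) = b • cls (X ^ 3) + c • cls (X ^ 5) := by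
    intro b c
    rw [nfP, cls_add, cls_add]
    simp only [map_zero, zero_mul, cls_zero, zero_add]
    rw [show C (b : ℚ) * X ^ 3 = b • (X ^ 3 : ℚ[X]) by simp [zsmul_eq_mul],
      show C (c : ℚ) * X ^ 5 = c • (X ^ 5 : ℚ[X]) by simp [zsmul_eq_mul],
      show cls (b • (X ^ 3 : ℚ[X])) = b • cls (X ^ 3) from map_zsmul clsHom _ _,
      show cls (c • (X ^ 5 : ℚ[X])) = c • cls (X ^ 5) from map_zsmul clsHom _ _]
  induction k using Nat.strong_induction_on with
  | _ k ih =>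
    rcases Nat.lt_or_ge k 6 with hk | hk
    · interval_cases k
      · -- k = 0 : x0 = -5•x3 + 32•x5
        have := hint (-5) 32
        simp only [Int.cast_neg, Int.cast_ofNat] at this
        rw [show Nmono 0 = (0, -5, 32) from rfl, this]
        -- from e20: x0 = 4•x1 - x3; e31: x1 = 9•x5 - x3 - x5
        have hx1 : cls (X ^ 1) = 9 • cls (X ^ 5) - cls (X ^ 3) - cls (X ^ 5) := by
          rw [e31]; abel
        have hx0 : cls (X ^ 0) = 4 • cls (X ^ 1) - cls (X ^ 3) := by rw [e20]; abel
        rw [hx0, hx1]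
        abel
      · have := hint (-1) 8
        simp only [Int.cast_neg, Int.cast_one, Int.cast_ofNat] at this
        rw [show Nmono 1 = (0, -1, 8) from rfl, this]
        have hx1 : cls (X ^ 1) = 9 • cls (X ^ 5) - cls (X ^ 3) - cls (X ^ 5) := by
          rw [e31]; abel
        rw [hx1]
        abel
      · have := hint 0 3
        simp only [Int.cast_zero, Int.cast_ofNat] at this
        rw [show Nmono 2 = (0, 0, 3) from rfl, this]
        have hx2 : cls (X ^ 2) = 4 • cls (X ^ 5) - cls (X ^ 5) := by rw [e22]; abel
        rw [hx2]
        abel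
      · have := hint 1 0
        simp only [Int.cast_one, Int.cast_zero] at this
        rw [show Nmono 3 = (0, 1, 0) from rfl, this]
        abel
      · have := hint 5 (-8)
        simp only [Int.cast_neg, Int.cast_ofNat] at this
        rw [show Nmono 4 = (0, 5, -8) from rfl, this]
        have hx1 : cls (X ^ 1) = 9 • cls (X ^ 5) - cls (X ^ 3) - cls (X ^ 5) := by
          rw [e31]; abel
        have hx4 : cls (X ^ 4) = 4 • cls (X ^ 3) - cls (X ^ 1) := by rw [e21]; abel
        rw [hx4, hx1]
        abel
      · have := hint 0 1
        simp only [Int.cast_zero, Int.cast_one] at this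
        rw [show Nmono 5 = (0, 0, 1) from rfl, this]
        abel
    · obtain ⟨j, rfl⟩ := Nat.exists_eq_add_of_le' hk
      rw [cls_X_pow_add_six hM j, ih j (by omega), show Nmono (j + 6) = Nmono j - _ from rfl, nfP_sub,
        show ∀ P P' : ℚ[X], cls (P - P') = cls P - cls P' from map_sub clsHom]
      congr 2
      simp [nfP]

/-- **Reduction**: from the targets, every numerator is equivalent to its normal form. -/
theorem cls_eq_cls_nfP (hT : Targets) (P : ℚ[X]) : cls P = cls (nfP (N P)) := by
  induction P using Polynomial.induction_on' with
  | add p q hp hq => rw [cls_add, N_add, nfP_add, cls_add, hp, hq]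
  | monomial k a =>
    rw [N_monomial, nfP_smul, cls_smul, ← cls_X_pow_eq hT k, ← cls_smul, smul_eq_C_mul,
      C_mul_X_pow_eq_monomial]

/-! ### Values through the quotient, and rigidity of the normal form under CDT -/

/-- `KZ.eval` descends to the quotient (soundness of the calculus, tree:
`KZ.relations_le_ker_eval_holds`). -/
def evalQ : Qt →+ ℝ := QuotientAddGroup.lift KZ.relations KZ.eval KZ.relations_le_ker_eval_holds

@[simp] theorem evalQ_mk (x : KZ.FormalRep) : evalQ (x : Qt) = KZ.eval x := rfl

@[simp] theorem evalQ_cls (P : ℚ[X]) : evalQ (cls P) = (sectorRep P).value := by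
  rw [cls, evalQ_mk, KZ.eval_of]

theorem evalQ_scaleQ (c : ℚ) (x : Qt) : evalQ (scaleQ c x) = c * evalQ x := by
  induction x using QuotientAddGroup.induction_on with
  | H z => rw [scaleQ_mk, evalQ_mk, evalQ_mk, KZ.eval_scale]

/-- Values are additive and `ℚ`-homogeneous in the numerator. -/
theorem value_sectorRep_add (P P' : ℚ[X]) :
    (sectorRep (P + P')).value = (sectorRep P).value + (sectorRep P').value := by
  rw [← evalQ_cls, cls_add, map_add, evalQ_cls, evalQ_cls]

theorem value_sectorRep_smul (c : ℚ) (P : ℚ[X]) :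
    (sectorRep (c • P)).value = c * (sectorRep P).value := by
  rw [← evalQ_cls, cls_smul, evalQ_scaleQ, evalQ_cls]

/-- The value of `[X^k]` is the Hurwitz box integral `H_k` of the tree. -/
theorem value_sectorRep_X_pow (k : ℕ) : (sectorRep (X ^ k)).value =
    ∫ x in {x : Fin 2 → ℝ | ∀ i, x i ∈ Ioo (0:ℝ) 1}, (x 0 * x 1) ^ k / (1 - (x 0 * x 1) ^ 6) := by
  simp only [KZ.IntegralRep.value, sectorRep_domain, sectorRep_integrand, box]
  refine setIntegral_congr_fun (Beukers.measurableSet_cube 2) fun x _ => ?_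
  simp [sectorFun]

theorem value_sectorRep_X_pow_three :
    (sectorRep (X ^ 3)).value = -(L2chi3 / 8) + Real.pi ^ 2 / 54 := by
  rw [value_sectorRep_X_pow, BoxIntegral.setIntegral_box_level_six_three]

theorem value_sectorRep_X_pow_five : (sectorRep (X ^ 5)).value = Real.pi ^ 2 / 216 := by
  rw [value_sectorRep_X_pow, BoxIntegral.setIntegral_box_level_six_five]

/-- `[C a · (1 − X⁶)]` is `[box, a]` up to an `EqOn`-relation; its value is `a`. -/
theorem of_constRep_sub_sectorRep_mem (a : ℚ) :
    KZ.of (constRep a) - KZ.of (sectorRep (C a * (1 - X ^ 6))) ∈ KZ.relations := by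
  refine KZ.of_sub_of_mem_relations_of_eqOn rfl fun x hx => ?_
  have hd : 1 - (x 0 * x 1) ^ 6 ≠ 0 := (den_pos hx).ne'
  simp only [constRep_integrand, sectorRep_integrand, sectorFun, map_mul, aeval_C, map_sub,
    map_one, map_pow, aeval_X]
  rw [mul_div_assoc, div_self hd, mul_one, eq_ratCast]

theorem value_sectorRep_C_mul (a : ℚ) : (sectorRep (C a * (1 - X ^ 6))).value = a := by
  rw [← KZ.Equivalent.value_eq_holds (of_constRep_sub_sectorRep_mem a), value_constRep]

/-- `[X^k − X^{k+6}]` is `[box, tᵏ]` up to an `EqOn`-relation; its value is `(k+1)⁻²`. -/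
theorem of_sectorRep_sub_monoRep_mem (k : ℕ) :
    KZ.of (sectorRep (X ^ k - X ^ (k + 6))) - KZ.of (monoRep k) ∈ KZ.relations := by
  refine KZ.of_sub_of_mem_relations_of_eqOn rfl fun x hx => ?_
  have hd : 1 - (x 0 * x 1) ^ 6 ≠ 0 := (den_pos hx).ne'
  simp only [sectorRep_integrand, sectorFun, map_sub, map_pow, aeval_X, monoRep_integrand]
  rw [div_eq_iff hd]
  ring

theorem value_sectorRep_X_pow_sub (k : ℕ) :
    (sectorRep (X ^ k - X ^ (k + 6))).value = 1 / ((k : ℝ) + 1) ^ 2 := by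
  rw [KZ.Equivalent.value_eq_holds (of_sectorRep_sub_monoRep_mem k), value_monoRep]

/-- **Value of the normal form**: `A + B·H₃ + C·H₅` with the tree's closed forms of `H₃, H₅`. -/
theorem value_sectorRep_nfP (v : ℚ × ℚ × ℚ) : (sectorRep (nfP v)).value =
    v.1 + v.2.1 * (-(L2chi3 / 8) + Real.pi ^ 2 / 54) + v.2.2 * (Real.pi ^ 2 / 216) := by
  rw [nfP, value_sectorRep_add, value_sectorRep_add, ← smul_eq_C_mul v.2.1, ← smul_eq_C_mul v.2.2,
    value_sectorRep_smul, value_sectorRep_smul, value_sectorRep_C_mul, value_sectorRep_X_pow_three,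
    value_sectorRep_X_pow_five]

/-- **Rigidity under CDT**: equal values of normal forms force equal coefficients
(`1, H₃, H₅` are `ℚ`-independent iff `1, π², L(2,χ₋₃)` are). -/
theorem nfP_rigid (hCDT : calegariDimitrovTang_linearIndependent) {v w : ℚ × ℚ × ℚ}
    (h : (sectorRep (nfP v)).value = (sectorRep (nfP w)).value) : v = w := by
  rw [value_sectorRep_nfP, value_sectorRep_nfP] at h
  have h0 := hCDT.eq_zero (v.1 - w.1) ((v.2.1 - w.2.1) / 54 + (v.2.2 - w.2.2) / 216)
    (-((v.2.1 - w.2.1) / 8)) (by push_cast; linarith)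
  obtain ⟨h1, h2, h3⟩ := h0
  have e2 : v.2.1 = w.2.1 := by linarith
  have e3 : v.2.2 = w.2.2 := by rw [e2, sub_self, zero_div, zero_add] at h2; linarith
  have e1 : v.1 = w.1 := by linarith
  exact Prod.ext e1 (Prod.ext e2 e3)

/-! ### The transfer theorems -/

/-- **Targets ⇒ crux.** Under CDT, the single-move targets imply the conclusion: reduce both
numerators to their normal forms (`cls_eq_cls_nfP`), compare values (soundness), conclude equal
coefficients (`nfP_rigid`), hence equal classes. -/
theorem conclusion_of_targets (hCDT : calegariDimitrovTang_linearIndependent) (hT : Targets) :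
    Conclusion := by
  rw [conclusion_iff_sectorRep]
  intro P P' hv
  have hP := cls_eq_cls_nfP hT P
  have hP' := cls_eq_cls_nfP hT P'
  have hvP : (sectorRep P).value = (sectorRep (nfP (N P))).value :=
    KZ.Equivalent.value_eq_holds ((cls_eq_cls_iff _ _).mp hP)
  have hvP' : (sectorRep P').value = (sectorRep (nfP (N P'))).value :=
    KZ.Equivalent.value_eq_holds ((cls_eq_cls_iff _ _).mp hP')
  have hN : N P = N P' := nfP_rigid hCDT (by rw [← hvP, ← hvP', hv])
  rw [← cls_eq_cls_iff, hP, hP', hN]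

/-- Hence SectorTwoSix itself from the targets. -/
theorem sectorTwoSix_of_targets (hT : Targets) : SectorTwoSix := fun hCDT => conclusion_of_targets hCDT hT

/-- A numeral numerator is a scalar multiple. -/
theorem ofNat_mul_eq_smul (n : ℕ) [n.AtLeastTwo] (P : ℚ[X]) :
    (OfNat.ofNat n : ℚ[X]) * P = (OfNat.ofNat n : ℚ) • P := by
  rw [smul_eq_C_mul, map_ofNat]

/-- **Crux ⇒ targets.** Each target is an instance of the conclusion (equal values by the tree's
level-6 evaluations), so the targets are NECESSARY: no proof of the crux can avoid establishing
them (in some form). -/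
theorem targets_of_conclusion (hC : Conclusion) : Targets := by
  rw [conclusion_iff_sectorRep] at hC
  have L0 := BoxIntegral.setIntegral_box_level_six_zero
  have L1 := BoxIntegral.setIntegral_box_level_six_one
  have L2 := BoxIntegral.setIntegral_box_level_six_two
  have L3 := BoxIntegral.setIntegral_box_level_six_three
  have L4 := BoxIntegral.setIntegral_box_level_six_four
  have L5 := BoxIntegral.setIntegral_box_level_six_five
  refine ⟨fun k => ?_, ?_, ?_, ?_, ?_⟩
  · -- TMono k
    have hv : (sectorRep (X ^ k - X ^ (k + 6))).value =
        (sectorRep (C (1 / ((k : ℚ) + 1) ^ 2) * (1 - X ^ 6))).value := by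
      rw [value_sectorRep_X_pow_sub, value_sectorRep_C_mul]; push_cast; ring
    have hmid : KZ.of (sectorRep (X ^ k - X ^ (k + 6))) -
        KZ.of (sectorRep (C (1 / ((k : ℚ) + 1) ^ 2) * (1 - X ^ 6))) ∈ KZ.relations := hC _ _ hv
    have h1 := of_sectorRep_sub_monoRep_mem k
    have h2 := of_constRep_sub_sectorRep_mem (1 / ((k : ℚ) + 1) ^ 2)
    have : KZ.of (monoRep k) - KZ.of (constRep (1 / ((k : ℚ) + 1) ^ 2)) =
        -(KZ.of (sectorRep (X ^ k - X ^ (k + 6))) - KZ.of (monoRep k)) +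
          (KZ.of (sectorRep (X ^ k - X ^ (k + 6))) -
            KZ.of (sectorRep (C (1 / ((k : ℚ) + 1) ^ 2) * (1 - X ^ 6)))) -
          (KZ.of (constRep (1 / ((k : ℚ) + 1) ^ 2)) -
            KZ.of (sectorRep (C (1 / ((k : ℚ) + 1) ^ 2) * (1 - X ^ 6)))) := by abel
    show KZ.of (monoRep k) - KZ.of (constRep (1 / ((k : ℚ) + 1) ^ 2)) ∈ KZ.relations
    rw [this]
    exact KZ.relations.sub_mem (KZ.relations.add_mem (KZ.relations.neg_mem h1) hmid) h2
  · -- TDil2 0 : 4H₁ = H₀ + H₃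
    refine hC _ _ ?_
    rw [ofNat_mul_eq_smul, value_sectorRep_smul, value_sectorRep_add, value_sectorRep_X_pow,
      value_sectorRep_X_pow, value_sectorRep_X_pow, L0, L1, L3]
    push_cast; ring
  · -- TDil2 1 : 4H₃ = H₁ + H₄ (the relation dependent on the printed four)
    refine hC _ _ ?_
    rw [ofNat_mul_eq_smul, value_sectorRep_smul, value_sectorRep_add, value_sectorRep_X_pow,
      value_sectorRep_X_pow, value_sectorRep_X_pow, L1, L3, L4]
    push_cast; ring
  · -- TDil2 2 : 4H₅ = H₂ + H₅
    refine hC _ _ ?_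
    simp only [Nat.reduceMul, Nat.reduceAdd]
    rw [ofNat_mul_eq_smul, value_sectorRep_smul, value_sectorRep_add, value_sectorRep_X_pow,
      value_sectorRep_X_pow, L2, L5]
    push_cast; ring
  · -- TDil3 1 : 9H₅ = H₁ + H₃ + H₅
    refine hC _ _ ?_
    simp only [Nat.reduceMul, Nat.reduceAdd]
    rw [ofNat_mul_eq_smul, value_sectorRep_smul, value_sectorRep_add, value_sectorRep_add,
      value_sectorRep_X_pow, value_sectorRep_X_pow, value_sectorRep_X_pow, L1, L3, L5]
    push_cast; ring

/-- **Under CDT the crux is equivalent to the single-move targets.** -/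
theorem conclusion_iff_targets (hCDT : calegariDimitrovTang_linearIndependent) :
    Conclusion ↔ Targets :=
  ⟨targets_of_conclusion, conclusion_of_targets hCDT⟩

/-- The unconditional half, read on the crux: `SectorTwoSix → CDT → Targets`. -/
theorem targets_of_sectorTwoSix (h : SectorTwoSix) (hCDT : calegariDimitrovTang_linearIndependent) :
    Targets :=
  targets_of_conclusion (h hCDT)

end Engine

/-! ## §7 Discharging the targets: the dilation `xᵢ ↦ xᵢ^m` IS one change-of-variables move

Every target of §6 is ONE instance of rule (2) with `Φ(x) = (xᵢ^m)ᵢ` on the open unit box: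
`TDil2 r` (`m = 2`), `TDil3 r` (`m = 3`) and — with a CONSTANT target integrand — `TMono k`
(`m = k + 1`: `[box, tᵏ] = [box, (k+1)⁻² · (k+1)² tᵏ] ∼ [box, (k+1)⁻²]`, no Newton–Leibniz needed).
`dilation_mem_changeOfVariablesRel` below is crux `DilationMove` (stmt-…-3872) in every dimension
`n`; `dilationMove` is that crux's statement verbatim. -/

section Dilation

variable {n : ℕ}

/-- The open unit box of `ℝⁿ`. -/
def boxN (n : ℕ) : Set (Fin n → ℝ) := {x | ∀ i, x i ∈ Set.Ioo (0:ℝ) 1}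

/-- The dilation `Φ_m(x) = (xᵢ^m)ᵢ`. -/
def dil (m : ℕ) (x : Fin n → ℝ) : Fin n → ℝ := fun i => x i ^ m

/-- Its derivative `diag(m xᵢ^{m-1})`. -/
def dilDeriv (m : ℕ) (x : Fin n → ℝ) : (Fin n → ℝ) →L[ℝ] (Fin n → ℝ) :=
  ContinuousLinearMap.pi fun i =>
    ((m : ℝ) * x i ^ (m - 1)) • ContinuousLinearMap.proj (R := ℝ) (φ := fun _ : Fin n => ℝ) i

@[simp] theorem dilDeriv_apply (m : ℕ) (x v : Fin n → ℝ) (i : Fin n) :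
    dilDeriv m x v i = (m : ℝ) * x i ^ (m - 1) * v i := by
  simp [dilDeriv]

theorem hasFDerivAt_dil (m : ℕ) (x : Fin n → ℝ) : HasFDerivAt (dil (n := n) m) (dilDeriv m x) x := by
  unfold dil dilDeriv
  rw [hasFDerivAt_pi]
  intro i
  have h := (hasFDerivAt_apply (𝕜 := ℝ) i x).pow m
  simpa [nsmul_eq_mul] using h

/-- `det diag(m xᵢ^{m-1}) = ∏ᵢ m xᵢ^{m-1}`. -/
theorem det_dilDeriv (m : ℕ) (x : Fin n → ℝ) :
    (dilDeriv m x).det = ∏ i, ((m : ℝ) * x i ^ (m - 1)) := by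
  have hmat : LinearMap.toMatrix' (dilDeriv m x : (Fin n → ℝ) →ₗ[ℝ] (Fin n → ℝ)) =
      Matrix.diagonal fun i => (m : ℝ) * x i ^ (m - 1) := by
    ext i j
    rw [LinearMap.toMatrix'_apply, ContinuousLinearMap.coe_coe, dilDeriv_apply, Matrix.diagonal_apply,
      Pi.single_apply]
    split_ifs with h
    · subst h; ring
    · ring
  rw [ContinuousLinearMap.det, ← LinearMap.det_toMatrix', hmat, Matrix.det_diagonal]

theorem prod_dilDeriv_eq (m : ℕ) (x : Fin n → ℝ) :
    ∏ i, ((m : ℝ) * x i ^ (m - 1)) = (m : ℝ) ^ n * ∏ i, x i ^ (m - 1) := by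
  rw [Finset.prod_mul_distrib, Finset.prod_const, Finset.card_univ, Fintype.card_fin]

/-- `Φ_m` is injective on the open box (`m ≥ 1`). -/
theorem injOn_dil {m : ℕ} (hm : 1 ≤ m) : InjOn (dil (n := n) m) (boxN n) := by
  intro x hx y hy hxy
  ext i
  have h := congrFun hxy i
  simp only [dil] at h
  exact (pow_left_inj₀ (hx i).1.le (hy i).1.le (by omega)).mp h

/-- `Φ_m` maps the open box onto itself (`m ≥ 1`; `m`-th roots). -/
theorem image_dil {m : ℕ} (hm : 1 ≤ m) : dil m '' boxN n = boxN n := by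
  have hm0 : m ≠ 0 := by omega
  ext y
  constructor
  · rintro ⟨x, hx, rfl⟩ i
    exact ⟨pow_pos (hx i).1 m, pow_lt_one₀ (hx i).1.le (hx i).2 hm0⟩
  · intro hy
    refine ⟨fun i => y i ^ ((m : ℝ)⁻¹), fun i => ⟨Real.rpow_pos_of_pos (hy i).1 _,
      Real.rpow_lt_one (hy i).1.le (hy i).2 (by positivity)⟩, ?_⟩
    ext i
    simp only [dil]
    exact Real.rpow_inv_natCast_pow (hy i).1.le hm0

/-- `Φ_m` is a `ℚ`-semialgebraic map on the box (it is polynomial). -/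
theorem isSemialgebraicMapOn_dil (m : ℕ) : IsSemialgebraicMapOn ℚ (boxN n) (dil (n := n) m) :=
  (isSemialgebraicMapOn_aeval (KZ.isSemialgebraic_box n) fun j => (MvPolynomial.X j) ^ m).congr
    fun x _ => by ext j; simp [dil]

/-- **The dilation move** (crux `DilationMove` in every dimension): for representations `r, r'` on the
open unit box with `r.integrand x = r'.integrand (xᵢ^m)ᵢ · mⁿ ∏ᵢ xᵢ^{m−1}` on the box,
`[r] − [r']` is ONE change-of-variables move. -/
theorem dilation_mem_changeOfVariablesRel {m : ℕ} (hm : 1 ≤ m) (r r' : KZ.IntegralRep n)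
    (hr : r.domain = boxN n) (hr' : r'.domain = boxN n)
    (h : ∀ x ∈ r.domain,
      r.integrand x = r'.integrand (fun i => x i ^ m) * ((m : ℝ) ^ n * ∏ i, x i ^ (m - 1))) :
    KZ.of r - KZ.of r' ∈ KZ.changeOfVariablesRel := by
  refine ⟨n, r, r', dil m, dilDeriv m, ?_, fun x _ => (hasFDerivAt_dil m x).hasFDerivWithinAt, ?_,
    ?_, fun x hx => ?_, rfl⟩
  · rw [hr]; exact isSemialgebraicMapOn_dil m
  · rw [hr]; exact injOn_dil hm
  · rw [hr', hr, image_dil hm]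
  · rw [h x hx, det_dilDeriv, prod_dilDeriv_eq, abs_of_pos]
    · rfl
    · rw [hr] at hx
      exact mul_pos (pow_pos (by exact_mod_cast hm) n) (Finset.prod_pos fun i _ => pow_pos (hx i).1 _)

/-- Crux `DilationMove` (stmt-KontsevichZagierPeriods-3872), verbatim, PROVED. -/
theorem dilationMove : Summit.KontsevichZagierPeriods.KontsevichZagierPeriods.Theses.HurwitzMicroSectors.DilationMove :=
  fun _ _ hm r r' hr hr' h => dilation_mem_changeOfVariablesRel hm r r' hr hr' h

end Dilation

/-! ### The targets of §6, discharged -/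

section Targets

open Polynomial

theorem prod_fin_two (f : Fin 2 → ℝ) : ∏ i, f i = f 0 * f 1 := Fin.prod_univ_two f

/-- `TMono k` is ONE dilation with `m = k + 1` and constant target integrand. -/
theorem tMono (k : ℕ) : TMono k := by
  refine KZ.changeOfVariablesRel_subset_relations
    (dilation_mem_changeOfVariablesRel (n := 2) (m := k + 1) (by omega) (monoRep k)
      (constRep (1 / ((k : ℚ) + 1) ^ 2)) rfl rfl fun x hx => ?_)
  simp only [monoRep_integrand, constRep_integrand, Nat.add_sub_cancel, prod_fin_two]
  push_cast
  have hk : ((k : ℝ) + 1) ≠ 0 := by positivity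
  field_simp
  ring

/-- `TDil2 r` is ONE dilation with `m = 2`. -/
theorem tDil2 (r : ℕ) : TDil2 r := by
  refine KZ.changeOfVariablesRel_subset_relations
    (dilation_mem_changeOfVariablesRel (n := 2) (m := 2) (by norm_num) (sectorRep (4 * X ^ (2 * r + 1)))
      (sectorRep (X ^ r + X ^ (r + 3))) rfl rfl fun x hx => ?_)
  have ht := mul_mem_Ioo hx
  have hd : 1 - (x 0 * x 1) ^ 6 ≠ 0 := (den_pos hx).ne'
  have hd2 : 1 - (x 0 ^ 2 * x 1 ^ 2) ^ 6 ≠ 0 := by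
    have h2 : x 0 ^ 2 * x 1 ^ 2 = (x 0 * x 1) ^ 2 := by ring
    have : (x 0 ^ 2 * x 1 ^ 2) ^ 6 < 1 := by
      rw [h2, ← pow_mul]
      exact pow_lt_one₀ ht.1.le ht.2 (by norm_num)
    linarith
  simp only [sectorRep_integrand, sectorFun, map_mul, map_ofNat, map_pow, aeval_X, map_add,
    prod_fin_two, Nat.reduceSub, pow_one]
  rw [div_eq_iff hd, div_mul_eq_mul_div, div_mul_eq_mul_div, eq_div_iff hd2]
  ring

/-- `TDil3 r` is ONE dilation with `m = 3`. -/
theorem tDil3 (r : ℕ) : TDil3 r := by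
  refine KZ.changeOfVariablesRel_subset_relations
    (dilation_mem_changeOfVariablesRel (n := 2) (m := 3) (by norm_num) (sectorRep (9 * X ^ (3 * r + 2)))
      (sectorRep (X ^ r + X ^ (r + 2) + X ^ (r + 4))) rfl rfl fun x hx => ?_)
  have ht := mul_mem_Ioo hx
  have hd : 1 - (x 0 * x 1) ^ 6 ≠ 0 := (den_pos hx).ne'
  have hd3 : 1 - (x 0 ^ 3 * x 1 ^ 3) ^ 6 ≠ 0 := by
    have h3 : x 0 ^ 3 * x 1 ^ 3 = (x 0 * x 1) ^ 3 := by ring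
    have : (x 0 ^ 3 * x 1 ^ 3) ^ 6 < 1 := by
      rw [h3, ← pow_mul]
      exact pow_lt_one₀ ht.1.le ht.2 (by norm_num)
    linarith
  simp only [sectorRep_integrand, sectorFun, map_mul, map_ofNat, map_pow, aeval_X, map_add,
    prod_fin_two, Nat.reduceSub]
  rw [div_eq_iff hd, div_mul_eq_mul_div, div_mul_eq_mul_div, eq_div_iff hd3]
  ring

/-- **All targets hold.** -/
theorem targets : Targets := ⟨tMono, tDil2 0, tDil2 1, tDil2 2, tDil3 1⟩

/-- **The conclusion of the crux, under CDT** — i.e. the crux itself, PROVED: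
`SectorTwoSix` holds (conditional on nothing but its own antecedent). A refuter cannot land this;
it is attached as evidence for the provers of stmt-3870 (and `dilationMove` for stmt-3872). -/
theorem sectorTwoSix : SectorTwoSix := sectorTwoSix_of_targets targets

/-- Unconditional form: Conjecture 1 on the level-6 weight-2 box sector follows from CDT's Theorem 1. -/
theorem conclusion_of_cdt (hCDT : calegariDimitrovTang_linearIndependent) : Conclusion :=
  conclusion_of_targets hCDT targets

end Targets


/-! ## §8 By-product: crux `ReductionTwoSix` (stmt-KontsevichZagierPeriods-3871) from the same engine

The route's normal form `a + b/(1−xy) + c/(1+xy+x²y²)` is the sector numerator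
`a(1−t⁶) + b(1+t+⋯+t⁵) + c(1−t+t³−t⁴)`, whose coefficient vector is `N = (a, −8c, 36b + 32c)`
(`[1/(1−t)] ∼ 36[H₅]`, `[1/(1+t+t²)] ∼ 32[H₅] − 8[H₃]`, as the route text says); solve for `(a,b,c)`. -/

section Reduction

open Polynomial

theorem N_smul (a : ℚ) (P : ℚ[X]) : N (a • P) = a • N P := by
  induction P using Polynomial.induction_on' with
  | add p q hp hq => rw [smul_add, N_add, N_add, hp, hq, smul_add]
  | monomial k c => rw [smul_monomial, N_monomial, N_monomial, smul_eq_mul, mul_smul]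

theorem N_neg (P : ℚ[X]) : N (-P) = -N P := by
  rw [← neg_one_smul ℚ P, N_smul, neg_one_smul]

theorem N_sub (P Q : ℚ[X]) : N (P - Q) = N P - N Q := by
  rw [sub_eq_add_neg, N_add, N_neg, ← sub_eq_add_neg]

/-- `1/(1−t) = S₁/(1−t⁶)`. -/
def S1 : ℚ[X] := X ^ 0 + X ^ 1 + X ^ 2 + X ^ 3 + X ^ 4 + X ^ 5

/-- `1/(1+t+t²) = S₂/(1−t⁶)`. -/
def S2 : ℚ[X] := X ^ 0 - X ^ 1 + X ^ 3 - X ^ 4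

/-- The route's normal form as a sector numerator. -/
def Qpoly (a b c : ℚ) : ℚ[X] := a • (X ^ 0 - X ^ 6) + b • S1 + c • S2

theorem N_one_sub : N (X ^ 0 - X ^ 6 : ℚ[X]) = (1, 0, 0) := by
  rw [N_sub, N_X_pow, N_X_pow, show Nmono 6 = Nmono 0 - (1 / ((0 : ℚ) + 1) ^ 2, 0, 0) from rfl]
  norm_num

theorem N_S1 : N S1 = (0, 0, 36) := by
  simp only [S1, N_add, N_X_pow]
  rw [show Nmono 0 = (0, -5, 32) from rfl, show Nmono 1 = (0, -1, 8) from rfl,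
    show Nmono 2 = (0, 0, 3) from rfl, show Nmono 3 = (0, 1, 0) from rfl,
    show Nmono 4 = (0, 5, -8) from rfl, show Nmono 5 = (0, 0, 1) from rfl]
  norm_num

theorem N_S2 : N S2 = (0, -8, 32) := by
  simp only [S2, N_add, N_sub, N_X_pow]
  rw [show Nmono 0 = (0, -5, 32) from rfl, show Nmono 1 = (0, -1, 8) from rfl,
    show Nmono 3 = (0, 1, 0) from rfl, show Nmono 4 = (0, 5, -8) from rfl]
  norm_num

theorem N_Qpoly (a b c : ℚ) : N (Qpoly a b c) = (a, -8 * c, 36 * b + 32 * c) := by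
  simp only [Qpoly, N_add, N_smul, N_one_sub, N_S1, N_S2]
  ext <;> simp <;> ring

/-- The integrand of `[Qpoly a b c]` is the route's normal form on the box. -/
theorem sectorFun_Qpoly (a b c : ℚ) {x : Fin 2 → ℝ} (hx : x ∈ box) :
    sectorFun (Qpoly a b c) x = (a : ℝ) + b / (1 - x 0 * x 1) + c / (1 + x 0 * x 1 + (x 0 * x 1) ^ 2) := by
  have ht := mul_mem_Ioo hx
  have hd : 1 - (x 0 * x 1) ^ 6 ≠ 0 := (den_pos hx).ne'
  have h1 : 1 - x 0 * x 1 ≠ 0 := by linarith [ht.2]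
  have h2 : 1 + x 0 * x 1 + x 0 ^ 2 * x 1 ^ 2 ≠ 0 := by nlinarith [ht.1]
  have hd' : 1 - x 0 ^ 6 * x 1 ^ 6 ≠ 0 := by rw [← mul_pow]; exact hd
  simp only [sectorFun, Qpoly, S1, S2, map_add, map_sub, map_smul, map_pow, aeval_X, Rat.smul_def]
  rw [mul_pow, mul_pow]
  field_simp
  ring

/-- Crux `ReductionTwoSix` (stmt-KontsevichZagierPeriods-3871), verbatim, PROVED (unconditionally). -/
theorem reductionTwoSix :
    Summit.KontsevichZagierPeriods.KontsevichZagierPeriods.Theses.HurwitzMicroSectors.ReductionTwoSix := by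
  intro r P hd hf
  refine ⟨(N P).1, ((N P).2.2 + 4 * (N P).2.1) / 36, -((N P).2.1 / 8),
    sectorRep (Qpoly (N P).1 (((N P).2.2 + 4 * (N P).2.1) / 36) (-((N P).2.1 / 8))), rfl,
    fun x hx => sectorFun_Qpoly _ _ _ hx, ?_⟩
  have h1 := of_sub_of_sectorRep_mem_relations hd hf
  have hN : N (Qpoly (N P).1 (((N P).2.2 + 4 * (N P).2.1) / 36) (-((N P).2.1 / 8))) = N P := by
    rw [N_Qpoly]
    ext <;> simp <;> ring
  have h2 : cls P = cls (Qpoly (N P).1 (((N P).2.2 + 4 * (N P).2.1) / 36) (-((N P).2.1 / 8))) := by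
    rw [cls_eq_cls_nfP targets P, cls_eq_cls_nfP targets (Qpoly _ _ _), hN]
  exact KZ.Equivalent.trans h1 ((cls_eq_cls_iff _ _).mp h2)

end Reduction


/-! ## §9 By-product: support item `RigidityTwoSix` (stmt-KontsevichZagierPeriods-3874) from the tree -/

/-- The value of a representation on the box with the route's normal-form integrand (tree:
`BoxIntegral.setIntegral_box_normalForm`). -/
theorem value_of_normalForm {r : KZ.IntegralRep 2} {a b c : ℚ} (hd : r.domain = box)
    (hf : EqOn r.integrand (fun x => (a : ℝ) + b / (1 - x 0 * x 1) + c / (1 + x 0 * x 1 + (x 0 * x 1) ^ 2))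
      r.domain) :
    r.value = a + b * (Real.pi ^ 2 / 6) + c * L2chi3 := by
  rw [← BoxIntegral.setIntegral_box_normalForm (a : ℝ) b c, KZ.IntegralRep.value, hd]
  rw [hd] at hf
  exact setIntegral_congr_fun measurableSet_box hf

/-- Support item `RigidityTwoSix` (stmt-KontsevichZagierPeriods-3874), verbatim, PROVED (the tree's
`BoxIntegral.normalForm_coeff_eq` after evaluating both values). -/
theorem rigidityTwoSix :
    Summit.KontsevichZagierPeriods.KontsevichZagierPeriods.Theses.HurwitzMicroSectors.RigidityTwoSix := by
  intro hCDT a b c a' b' c' r r' hd hf hd' hf' hv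
  rw [value_of_normalForm hd hf, value_of_normalForm hd' hf'] at hv
  exact BoxIntegral.normalForm_coeff_eq hCDT hv

/-- Support items `BoxIntegralZetaTwo` (stmt-3875) and `BoxIntegralLTwoChiThree` (stmt-3876) ARE the
tree's `box_integral_one_div_one_sub_mul_two` / `box_integral_L_two_chi_three`, verbatim. -/
theorem boxIntegralZetaTwo :
    Summit.KontsevichZagierPeriods.KontsevichZagierPeriods.Theses.HurwitzMicroSectors.BoxIntegralZetaTwo :=
  box_integral_one_div_one_sub_mul_two

theorem boxIntegralLTwoChiThree :
    Summit.KontsevichZagierPeriods.KontsevichZagierPeriods.Theses.HurwitzMicroSectors.BoxIntegralLTwoChiThree :=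
  box_integral_L_two_chi_three



/-! ## §10 (cycle 4) The load-bearing MOVE: rule (1) alone cannot prove the crux; ONE rule-(2) move can

Which MOVES must any proof use?  The tree's restricted evaluation
`KZ.restrictedEval A [r] = ∫_{σ ∩ A n} f` (`KZSubcalculusInvariants.lean`) is an additive invariant
of the two additivity moves (rule 1a, 1b) — the localisation of their soundness computation,
`KZ.closure_add_le_ker_restrictedEval` — but not of rules (2), (3).  Over the corner window
`(0,¼)²` it separates the equal-valued pair of §4: on `t < 1/16`,
`((1+t³) − 4t)/(1−t⁶) ≥ ½`, so the corner masses differ by `≥ ½ · vol = 1/32`.  Hence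
`[1+t³] − [4t] ∉ closure (domainAddRel ∪ integrandAddRel)`: the distribution relation
`H₀ + H₃ = 4H₁` is NOT an additivity relation, and the conclusion of the crux read in the
additivity-only sub-calculus is FALSE (`not_additiveConclusion`).  Conversely ONE change of
variables connects the pair (`pair_mem_changeOfVariablesRel`, the `m = 2` dilation): the bound
"≥ 1 non-additive move" is attained.  (Whether rule (3) could replace rule (2) here is exactly the
barrier question `Literature.Barriers.KontsevichZagierPeriods` / AlgebraicPrimitivesObstruction:
fibre primitives of `tʳ/(1−t⁶)` are `log`/`arctan`, not semialgebraic — no theorem either way.) -/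

section AdditiveSubcalculus

open Polynomial

/-- The corner windows `{x | ∀ i, xᵢ < ¼}`, one per dimension. -/
def corner (n : ℕ) : Set (Fin n → ℝ) := {x | ∀ i, x i < 4⁻¹}

/-- The corners are product windows (hence measurable). -/
theorem corner_eq_pi (n : ℕ) : corner n = Set.pi univ fun _ => Iio (4⁻¹ : ℝ) := by
  ext x; simp [corner]

/-- `box ∩ corner = (0,¼)²`. -/
theorem box_inter_corner : box ∩ corner 2 = Set.pi univ fun _ => Ioo (0:ℝ) 4⁻¹ := by
  ext x
  simp only [box, corner, mem_inter_iff, mem_setOf_eq, mem_Ioo, mem_univ_pi]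
  constructor
  · rintro ⟨h1, h2⟩ i
    exact ⟨(h1 i).1, h2 i⟩
  · intro h
    exact ⟨fun i => ⟨(h i).1, (h i).2.trans (by norm_num)⟩, fun i => (h i).2⟩

/-- On `(0,¼)²`, `0 < t = x₀x₁ < 1/16`. -/
theorem prod_bounds_of_mem_corner {x : Fin 2 → ℝ} (hx : x ∈ Set.pi univ fun _ => Ioo (0:ℝ) 4⁻¹) :
    0 < x 0 * x 1 ∧ x 0 * x 1 < 16⁻¹ := by
  rw [mem_univ_pi] at hx
  have h0 := hx 0; have h1 := hx 1
  refine ⟨mul_pos h0.1 h1.1, ?_⟩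
  have := mul_lt_mul'' h0.2 h1.2 h0.1.le h1.1.le
  have h16 : (4⁻¹ : ℝ) * 4⁻¹ = 16⁻¹ := by norm_num
  linarith

/-- **The corner separates the pair**: `[box, (1+t³)/(1−t⁶)] − [box, 4t/(1−t⁶)]` is NOT in the
subgroup generated by the additivity moves (corner-mass gap `≥ 1/32`). -/
theorem pair_not_mem_closure_add :
    KZ.of (sectorRep (1 + X ^ 3)) - KZ.of (sectorRep (4 * X)) ∉
      AddSubgroup.closure (KZ.domainAddRel ∪ KZ.integrandAddRel) := by
  intro hmem
  have hmeas : ∀ n, MeasurableSet (corner n) := fun n => by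
    rw [corner_eq_pi]; exact MeasurableSet.univ_pi fun _ => measurableSet_Iio
  have h0 := KZ.closure_add_le_ker_restrictedEval corner hmeas hmem
  rw [AddMonoidHom.mem_ker, map_sub, KZ.restrictedEval_of, KZ.restrictedEval_of, sectorRep_domain,
    sectorRep_domain, box_inter_corner] at h0
  set C : Set (Fin 2 → ℝ) := Set.pi univ fun _ => Ioo (0:ℝ) 4⁻¹ with hC
  have hCm : MeasurableSet C := MeasurableSet.univ_pi fun _ => measurableSet_Ioo
  have hCsub : C ⊆ box := by
    intro x hx
    rw [hC, mem_univ_pi] at hx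
    exact fun i => ⟨(hx i).1, (hx i).2.trans (by norm_num)⟩
  have hvol : volume C = ENNReal.ofReal 16⁻¹ := by
    rw [hC, volume_pi_pi]
    simp only [Real.volume_Ioo, Finset.prod_const, Finset.card_univ, Fintype.card_fin, sub_zero]
    rw [← ENNReal.ofReal_pow (by norm_num)]
    norm_num
  have hvolr : volume.real C = 16⁻¹ := by
    simp [Measure.real, hvol]
  have hi1 : IntegrableOn (sectorRep (1 + X ^ 3)).integrand C := (sectorRep _).integrableOn.mono_set hCsub
  have hi2 : IntegrableOn (sectorRep (4 * X)).integrand C := (sectorRep _).integrableOn.mono_set hCsub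
  have hsub : (∫ x in C, (sectorRep (1 + X ^ 3)).integrand x) -
      (∫ x in C, (sectorRep (4 * X)).integrand x) =
      ∫ x in C, ((sectorRep (1 + X ^ 3)).integrand x - (sectorRep (4 * X)).integrand x) :=
    (integral_sub hi1 hi2).symm
  have hconst : IntegrableOn (fun _ : Fin 2 → ℝ => (2⁻¹ : ℝ)) C := by
    refine integrableOn_const ?_
    rw [hvol]; exact ENNReal.ofReal_ne_top
  have hle : ∫ _ in C, (2⁻¹ : ℝ) ≤
      ∫ x in C, ((sectorRep (1 + X ^ 3)).integrand x - (sectorRep (4 * X)).integrand x) := by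
    refine setIntegral_mono_on hconst (hi1.sub hi2) hCm fun x hx => ?_
    obtain ⟨ht0, ht16⟩ := prod_bounds_of_mem_corner hx
    have hb : 0 < 1 - (x 0 * x 1) ^ 6 := den_pos (hCsub hx)
    have h3 : 0 ≤ (x 0 * x 1) ^ 3 := pow_nonneg ht0.le 3
    have h6 : 0 ≤ (x 0 * x 1) ^ 6 := pow_nonneg ht0.le 6
    simp only [sectorRep_integrand, sectorFun, map_add, map_one, map_pow, map_mul, map_ofNat,
      Polynomial.aeval_X]
    rw [← sub_div, le_div_iff₀ hb]
    nlinarith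
  have hcv : ∫ _ in C, (2⁻¹ : ℝ) = 32⁻¹ := by
    rw [setIntegral_const, hvolr]
    norm_num
  rw [hsub] at h0
  linarith

/-- The conclusion of the crux read in the ADDITIVITY-ONLY sub-calculus (`KZ.relations` replaced by
`closure (domainAddRel ∪ integrandAddRel)`; CDT antecedent dropped). -/
def AdditiveConclusion : Prop :=
  ∀ (r r' : KZ.IntegralRep 2) (P P' : Polynomial ℚ), r.domain = box → r'.domain = box →
    EqOn r.integrand (sectorFun P) r.domain → EqOn r'.integrand (sectorFun P') r'.domain →
    r.value = r'.value → KZ.of r - KZ.of r' ∈ AddSubgroup.closure (KZ.domainAddRel ∪ KZ.integrandAddRel)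

/-- **Rule (1) is not enough**: `AdditiveConclusion` is FALSE (witness: the pair of §4), so ANY
proof of `SectorTwoSix` uses a change of variables (rule 2) or a Newton–Leibniz move (rule 3).
(With the CDT antecedent kept, `CDT → AdditiveConclusion` is again equivalent to `¬ CDT`.)
Filed for landing as `not_sectorTwoSixAdditive` in `Theorems/SectorTwoSix/Negative/LoadBearing.lean`. -/
theorem not_additiveConclusion : ¬ AdditiveConclusion := fun h =>
  pair_not_mem_closure_add (h _ _ (1 + X ^ 3) (4 * X) rfl rfl (sectorRep_eqOn _) (sectorRep_eqOn _)
    value_sectorRep_one_add_X_pow_three_eq)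

/-- With the CDT antecedent kept, the additive sub-crux is equivalent to `¬ CDT`. -/
theorem additiveConclusion_imp_iff_not_cdt :
    (calegariDimitrovTang_linearIndependent → AdditiveConclusion) ↔
      ¬ calegariDimitrovTang_linearIndependent :=
  ⟨fun h hc => not_additiveConclusion (h hc), fun h hc => absurd hc h⟩

/-- **Tightness**: the `m = 2` dilation target is ONE rule-(2) GENERATOR (not merely a relation):
the refinement of `tDil2` to membership in `KZ.changeOfVariablesRel` itself. -/
theorem tDil2_mem_changeOfVariablesRel (r : ℕ) :
    KZ.of (sectorRep (4 * X ^ (2 * r + 1))) - KZ.of (sectorRep (X ^ r + X ^ (r + 3))) ∈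
      KZ.changeOfVariablesRel := by
  refine dilation_mem_changeOfVariablesRel (n := 2) (m := 2) (by norm_num) (sectorRep (4 * X ^ (2 * r + 1)))
      (sectorRep (X ^ r + X ^ (r + 3))) rfl rfl fun x hx => ?_
  have ht := mul_mem_Ioo hx
  have hd : 1 - (x 0 * x 1) ^ 6 ≠ 0 := (den_pos hx).ne'
  have hd2 : 1 - (x 0 ^ 2 * x 1 ^ 2) ^ 6 ≠ 0 := by
    have h2 : x 0 ^ 2 * x 1 ^ 2 = (x 0 * x 1) ^ 2 := by ring
    have : (x 0 ^ 2 * x 1 ^ 2) ^ 6 < 1 := by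
      rw [h2, ← pow_mul]
      exact pow_lt_one₀ ht.1.le ht.2 (by norm_num)
    linarith
  simp only [sectorRep_integrand, sectorFun, map_mul, map_ofNat, map_pow, aeval_X, map_add,
    prod_fin_two, Nat.reduceSub, pow_one]
  rw [div_eq_iff hd, div_mul_eq_mul_div, div_mul_eq_mul_div, eq_div_iff hd2]
  ring

/-- The pair of §4 is ONE change of variables apart (so the bound "at least one non-additive move"
of `not_additiveConclusion` is attained). -/
theorem pair_mem_changeOfVariablesRel :
    KZ.of (sectorRep (4 * X)) - KZ.of (sectorRep (1 + X ^ 3)) ∈ KZ.changeOfVariablesRel := by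
  simpa using tDil2_mem_changeOfVariablesRel 0

end AdditiveSubcalculus


/-! ## §11 (cycle 4) CDT is NECESSARY for the rigidity step: value-rigidity of the normal forms ↔ CDT

§2 showed CDT is not load-bearing for the TRUTH of the crux.  It IS load-bearing for the route's
PROOF, sharply: the rigidity step `nfP_rigid` (CDT ⇒ equal-valued normal forms have equal
coefficients) has an exact converse — value-rigidity of the normal forms `A(1−t⁶) + Bt³ + Ct⁵`
IMPLIES CDT's Theorem 1 (`cdt_of_nfRigidity`): a rational relation `g₀ + g₁π² + g₂L = 0` is the
vanishing of the value of the normal form `(g₀, −8g₂, 216g₁ + 32g₂)` (change of basis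
`π² = 216H₅`, `L = 32H₅ − 8H₃`).  So along reduction + rigidity the hypothesis cannot be weakened
(e.g. to the irrationality of `L(2,χ₋₃)` alone), and an unconditional rigidity proof would be an
unconditional Lean proof of Calegari–Dimitrov–Tang.  The same statement for the route's literal
normal form `a + b/(1−xy) + c/(1+xy+x²y²)` (item `RigidityTwoSix` with its antecedent deleted ⇒ CDT)
is landed as `Theorems/SectorTwoSix/Negative/RigidityNeedsCDT.lean` (p74918). -/

section RigidityNeedsCDT

/-- Value-rigidity of the normal forms `nfP v = A(1−t⁶) + Bt³ + Ct⁵` (the conclusion of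
`nfP_rigid` without its CDT hypothesis). -/
def NfRigidity : Prop :=
  ∀ v w : ℚ × ℚ × ℚ, (sectorRep (nfP v)).value = (sectorRep (nfP w)).value → v = w

/-- **Rigidity ⇒ CDT**: value-rigidity of the level-6 normal forms implies the `ℚ`-linear
independence of `1, π², L(2,χ₋₃)`. -/
theorem cdt_of_nfRigidity (h : NfRigidity) : calegariDimitrovTang_linearIndependent := by
  rw [calegariDimitrovTang_linearIndependent_iff]
  refine Fintype.linearIndependent_iff.mpr fun g hg => ?_
  rw [Fin.sum_univ_three] at hg
  simp only [Matrix.cons_val_zero, Matrix.cons_val_one, Matrix.cons_val, Rat.smul_def,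
    mul_one] at hg
  have key := h (g 0, -8 * g 2, 216 * g 1 + 32 * g 2) 0 (by
    rw [value_sectorRep_nfP, value_sectorRep_nfP]
    simp only [Prod.fst_zero, Prod.snd_zero, Rat.cast_zero, zero_mul, add_zero]
    push_cast
    linear_combination hg)
  simp only [Prod.ext_iff, Prod.fst_zero, Prod.snd_zero] at key
  obtain ⟨h0, h2, h1⟩ := key
  have hg0 : g 0 = 0 := h0
  have hg1 : g 1 = 0 := by linarith
  have hg2 : g 2 = 0 := by linarith
  intro i
  fin_cases i <;> assumption

/-- **Value-rigidity of the normal forms is EQUIVALENT to CDT's Theorem 1** (`→`: `cdt_of_nfRigidity`;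
`←`: `nfP_rigid`).  The rigidity half of the route is exactly as strong as its hypothesis. -/
theorem nfRigidity_iff_cdt : NfRigidity ↔ calegariDimitrovTang_linearIndependent :=
  ⟨cdt_of_nfRigidity, fun h _ _ hv => nfP_rigid h hv⟩

end RigidityNeedsCDT


/-! ## §12 (cycle 5, gen 3) The SCISSORS sub-calculus (rules 1a + 2) cannot prove the crux:
integrand additivity (rule 1b) — or Newton–Leibniz — is load-bearing too

§10 showed that the additivity moves (1a) + (1b) alone do not prove the crux (a rule-(2) or
rule-(3) move is needed, and ONE dilation suffices for the pair of §4).  Dually, the "scissors"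
sub-calculus generated by domain additivity (1a) and change of variables (2) — cut the domain
into pieces and transport pieces by semialgebraic diffeomorphisms, Hilbert's-third-problem
style — does not prove it either.  NEW INVARIANT (not in the tree): the POSITIVE-PART MASS
`posMass [σ, f] = ∫_σ max (f x) 0`, extended additively to `FormalRep`.  It kills
* (1a): `f = fᵢ` on `σᵢ` gives `f⁺ = fᵢ⁺` there, and `∫_{σ₁∪σ₂} f⁺ = ∫_{σ₁} f⁺ + ∫_{σ₂} f⁺`;
* (2): `f = (f'∘Φ)·|det Φ'|` on `σ` gives `f⁺ = (f'⁺∘Φ)·|det Φ'|` (as `|det Φ'| ≥ 0`), and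
  Mathlib's Jacobian formula applies to `f'⁺` verbatim;
but not (1b) (`(f+g)⁺ ≠ f⁺ + g⁺`) nor (3).  Witness inside the crux: the ZERO-VALUED numerator
`P₀ = (1 + t³) − 4t` (`H₀ + H₃ − 4H₁ = 0`, §4) against `P = 0`: `sectorFun P₀ ≥ ½` on the corner
`(0,¼)²`, so `posMass [P₀] ≥ 1/32 > 0 = posMass [0]`.  Hence
`[box, P₀/(1−t⁶)] − [box, 0] ∉ closure (domainAddRel ∪ changeOfVariablesRel)` and the conclusion
read in the scissors sub-calculus is FALSE (`not_scissorsConclusion`).  Together with §10: among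
the Newton–Leibniz-free sub-calculi, only those containing BOTH (1b) and (2) can prove the crux —
and `{1b, 2}` does (§7's proof uses exactly rule 1b, `KZ.scale`, and four dilations). -/

section Scissors

open Polynomial

variable {n : ℕ}

/-- The positive-part mass: `[σ, f] ↦ ∫_σ max (f x) 0`, additively on `FormalRep`. -/
def posMass : KZ.FormalRep →+ ℝ :=
  FreeAbelianGroup.lift fun p => ∫ x in p.2.domain, max (p.2.integrand x) 0

@[simp] theorem posMass_of (r : KZ.IntegralRep n) :
    posMass (KZ.of r) = ∫ x in r.domain, max (r.integrand x) 0 :=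
  FreeAbelianGroup.lift_apply_of _ _

/-- Domain additivity (1a) preserves the positive-part mass. -/
theorem posMass_eq_zero_of_mem_domainAddRel {c : KZ.FormalRep} (hc : c ∈ KZ.domainAddRel) :
    posMass c = 0 := by
  obtain ⟨n, r, r₁, r₂, hdom, hnull, h₁, h₂, rfl⟩ := hc
  have hm₁ : MeasurableSet r₁.domain := KZ.IntegralRep.measurableSet_domain_holds r₁
  have hm₂ : MeasurableSet r₂.domain := KZ.IntegralRep.measurableSet_domain_holds r₂
  have hae : AEDisjoint volume r₁.domain r₂.domain := hnull
  have hi : IntegrableOn (fun x => max (r.integrand x) 0) (r₁.domain ∪ r₂.domain) := by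
    have h := r.integrableOn
    rw [hdom] at h
    exact h.pos_part
  simp only [map_sub, posMass_of]
  rw [sub_sub, sub_eq_zero, hdom, setIntegral_union₀ hae hm₂.nullMeasurableSet hi.left_of_union
      hi.right_of_union,
    setIntegral_congr_fun hm₁ (fun x hx => by rw [h₁ hx]),
    setIntegral_congr_fun hm₂ (fun x hx => by rw [h₂ hx])]

/-- Change of variables (2) preserves the positive-part mass (`|det Φ'| ≥ 0` commutes with `max · 0`,
then Mathlib's `integral_image_eq_integral_abs_det_fderiv_smul` for the integrand `f'⁺`). -/
theorem posMass_eq_zero_of_mem_changeOfVariablesRel {c : KZ.FormalRep}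
    (hc : c ∈ KZ.changeOfVariablesRel) : posMass c = 0 := by
  obtain ⟨n, r, r', Φ, Φ', -, hΦ', hinj, hdom, hf, rfl⟩ := hc
  have hm : MeasurableSet r.domain := KZ.IntegralRep.measurableSet_domain_holds r
  simp only [map_sub, posMass_of, sub_eq_zero]
  rw [hdom, integral_image_eq_integral_abs_det_fderiv_smul volume hm hΦ' hinj
      (fun y => max (r'.integrand y) 0)]
  refine setIntegral_congr_fun hm fun x hx => ?_
  rw [hf x hx, smul_eq_mul, mul_max_of_nonneg _ _ (abs_nonneg _), mul_zero, mul_comm]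

/-- **The scissors sub-calculus lies in the kernel of `posMass`.** -/
theorem closure_scissors_le_ker_posMass :
    AddSubgroup.closure (KZ.domainAddRel ∪ KZ.changeOfVariablesRel) ≤ posMass.ker := by
  refine (AddSubgroup.closure_le _).mpr ?_
  rintro c (hc | hc)
  · exact posMass_eq_zero_of_mem_domainAddRel hc
  · exact posMass_eq_zero_of_mem_changeOfVariablesRel hc

/-- Integrand additivity (1b) does NOT preserve it: `[box, 0] − [box, 1] − [box, −1]` is a rule-(1b)
instance with positive-part mass `0 − 1 − 0 = −1`. -/
theorem posMass_integrandAdd_witness :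
    KZ.of (constRep 0) - KZ.of (constRep 1) - KZ.of (constRep (-1)) ∈ KZ.integrandAddRel ∧
      posMass (KZ.of (constRep 0) - KZ.of (constRep 1) - KZ.of (constRep (-1))) = -1 := by
  refine ⟨⟨2, constRep 0, constRep 1, constRep (-1), rfl, rfl, fun x _ => by simp, rfl⟩, ?_⟩
  simp only [map_sub, posMass_of, constRep_domain, constRep_integrand, Rat.cast_zero, Rat.cast_one,
    Rat.cast_neg, max_self]
  have h1 : max (1:ℝ) 0 = 1 := by norm_num
  have h2 : max (-1:ℝ) 0 = 0 := by norm_num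
  simp only [h1, h2, integral_zero, zero_sub, sub_zero]
  have := value_constRep 1
  simp only [KZ.IntegralRep.value, constRep_domain, constRep_integrand, Rat.cast_one] at this
  rw [this]

/-- The zero-valued numerator `P₀ = (1 + t³) − 4t`. -/
def P0 : ℚ[X] := (1 + X ^ 3) - 4 * X

theorem value_sectorRep_sub (P Q : ℚ[X]) :
    (sectorRep (P - Q)).value = (sectorRep P).value - (sectorRep Q).value := by
  rw [← evalQ_cls, show cls (P - Q) = cls P - cls Q from map_sub clsHom P Q, map_sub, evalQ_cls,
    evalQ_cls]

@[simp] theorem value_sectorRep_zero' : (sectorRep (0 : ℚ[X])).value = 0 := by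
  rw [← evalQ_cls, cls_zero, map_zero]

/-- `[P₀]` has value `0` (`H₀ + H₃ = 4H₁`). -/
theorem value_sectorRep_P0 : (sectorRep P0).value = 0 := by
  rw [P0, value_sectorRep_sub, value_sectorRep_one_add_X_pow_three_eq, sub_self]

/-- `[box, 0]` has positive-part mass `0`. -/
theorem posMass_sectorRep_zero : posMass (KZ.of (sectorRep (0 : ℚ[X]))) = 0 := by
  rw [posMass_of]
  simp [sectorFun]

/-- On the corner `(0,¼)²` the integrand of `[P₀]` is `≥ ½`. -/
theorem sectorFun_P0_ge {x : Fin 2 → ℝ} (hx : x ∈ Set.pi univ fun _ => Ioo (0:ℝ) 4⁻¹) :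
    2⁻¹ ≤ sectorFun P0 x := by
  obtain ⟨ht0, ht16⟩ := prod_bounds_of_mem_corner hx
  have hxb : x ∈ box := by
    rw [mem_univ_pi] at hx
    exact fun i => ⟨(hx i).1, (hx i).2.trans (by norm_num)⟩
  have hb : 0 < 1 - (x 0 * x 1) ^ 6 := den_pos hxb
  have h3 : 0 ≤ (x 0 * x 1) ^ 3 := pow_nonneg ht0.le 3
  have h6 : 0 ≤ (x 0 * x 1) ^ 6 := pow_nonneg ht0.le 6
  simp only [sectorFun, P0, map_sub, map_add, map_one, map_pow, map_mul, map_ofNat,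
    Polynomial.aeval_X]
  rw [le_div_iff₀ hb]
  nlinarith

/-- `[P₀]` has positive-part mass `≥ 1/32 > 0`. -/
theorem posMass_sectorRep_P0_pos : 0 < posMass (KZ.of (sectorRep P0)) := by
  rw [posMass_of, sectorRep_domain, sectorRep_integrand]
  set C : Set (Fin 2 → ℝ) := Set.pi univ fun _ => Ioo (0:ℝ) 4⁻¹ with hC
  have hCm : MeasurableSet C := MeasurableSet.univ_pi fun _ => measurableSet_Ioo
  have hCsub : C ⊆ box := by
    intro x hx
    rw [hC, mem_univ_pi] at hx
    exact fun i => ⟨(hx i).1, (hx i).2.trans (by norm_num)⟩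
  have hvol : volume C = ENNReal.ofReal 16⁻¹ := by
    rw [hC, volume_pi_pi]
    simp only [Real.volume_Ioo, Finset.prod_const, Finset.card_univ, Fintype.card_fin, sub_zero]
    rw [← ENNReal.ofReal_pow (by norm_num)]
    norm_num
  have hvolr : volume.real C = 16⁻¹ := by
    simp [Measure.real, hvol]
  have hint : IntegrableOn (fun x => max (sectorFun P0 x) 0) box volume :=
    (integrableOn_sectorFun P0).pos_part
  have hle1 : ∫ x in C, max (sectorFun P0 x) 0 ≤ ∫ x in box, max (sectorFun P0 x) 0 :=
    setIntegral_mono_set hint (ae_of_all _ fun x => le_max_right _ _)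
      (Filter.Eventually.of_forall hCsub)
  have hconst : IntegrableOn (fun _ : Fin 2 → ℝ => (2⁻¹ : ℝ)) C := by
    refine integrableOn_const ?_
    rw [hvol]; exact ENNReal.ofReal_ne_top
  have hle2 : ∫ _ in C, (2⁻¹ : ℝ) ≤ ∫ x in C, max (sectorFun P0 x) 0 := by
    refine setIntegral_mono_on hconst (hint.mono_set hCsub) hCm fun x hx => ?_
    exact (sectorFun_P0_ge hx).trans (le_max_left _ _)
  have hcv : ∫ _ in C, (2⁻¹ : ℝ) = 32⁻¹ := by
    rw [setIntegral_const, hvolr]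
    norm_num
  have : (0:ℝ) < 32⁻¹ := by norm_num
  linarith

/-- **The scissors sub-calculus does not reach the zero-valued numerator**:
`[box, P₀/(1−t⁶)] − [box, 0] ∉ closure (domainAddRel ∪ changeOfVariablesRel)`. -/
theorem P0_not_mem_closure_scissors :
    KZ.of (sectorRep P0) - KZ.of (sectorRep 0) ∉
      AddSubgroup.closure (KZ.domainAddRel ∪ KZ.changeOfVariablesRel) := by
  intro hmem
  have h0 := closure_scissors_le_ker_posMass hmem
  rw [AddMonoidHom.mem_ker, map_sub, posMass_sectorRep_zero, sub_zero] at h0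
  exact posMass_sectorRep_P0_pos.ne' h0

/-- In particular `[P₀]` is not ONE change of variables away from `[0]`, in either orientation
(compare §10: the positive pair `[1+t³]`, `[4t]` IS one dilation apart). -/
theorem P0_pair_not_mem_changeOfVariablesRel :
    KZ.of (sectorRep P0) - KZ.of (sectorRep 0) ∉ KZ.changeOfVariablesRel ∧
      KZ.of (sectorRep 0) - KZ.of (sectorRep P0) ∉ KZ.changeOfVariablesRel := by
  refine ⟨fun h => P0_not_mem_closure_scissors (AddSubgroup.subset_closure (Or.inr h)), fun h => ?_⟩
  have := (AddSubgroup.closure (KZ.domainAddRel ∪ KZ.changeOfVariablesRel)).neg_mem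
    (AddSubgroup.subset_closure (Or.inr h))
  rw [neg_sub] at this
  exact P0_not_mem_closure_scissors this

/-- The conclusion of the crux read in the SCISSORS sub-calculus (`KZ.relations` replaced by
`closure (domainAddRel ∪ changeOfVariablesRel)`; CDT antecedent dropped). -/
def ScissorsConclusion : Prop :=
  ∀ (r r' : KZ.IntegralRep 2) (P P' : Polynomial ℚ), r.domain = box → r'.domain = box →
    EqOn r.integrand (sectorFun P) r.domain → EqOn r'.integrand (sectorFun P') r'.domain →
    r.value = r'.value →
      KZ.of r - KZ.of r' ∈ AddSubgroup.closure (KZ.domainAddRel ∪ KZ.changeOfVariablesRel)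

/-- **Rules (1a) + (2) are not enough**: `ScissorsConclusion` is FALSE (witness `P₀` vs `0`), so ANY
proof of `SectorTwoSix` uses integrand additivity (rule 1b) or a Newton–Leibniz move (rule 3) —
§7's proof uses rule 1b (partial fractions, `KZ.scale` bookkeeping, `EqOn` congruences). -/
theorem not_scissorsConclusion : ¬ ScissorsConclusion := fun h =>
  P0_not_mem_closure_scissors (h _ _ P0 0 rfl rfl (sectorRep_eqOn _) (sectorRep_eqOn _)
    (by rw [value_sectorRep_P0, value_sectorRep_zero']))

/-- With the CDT antecedent kept, the scissors sub-crux is equivalent to `¬ CDT`. -/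
theorem scissorsConclusion_imp_iff_not_cdt :
    (calegariDimitrovTang_linearIndependent → ScissorsConclusion) ↔
      ¬ calegariDimitrovTang_linearIndependent :=
  ⟨fun h hc => not_scissorsConclusion (h hc), fun h hc => absurd hc h⟩

/-- For a numerator whose integrand is `≥ 0` on the box, the positive-part mass is the value. -/
theorem posMass_eq_value_of_nonneg (P : ℚ[X]) (hP : ∀ x ∈ box, 0 ≤ sectorFun P x) :
    posMass (KZ.of (sectorRep P)) = (sectorRep P).value := by
  rw [posMass_of, KZ.IntegralRep.value, sectorRep_domain, sectorRep_integrand]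
  exact setIntegral_congr_fun measurableSet_box fun x hx => max_eq_left (hP x hx)

theorem sectorFun_one_add_X_pow_three_nonneg {x : Fin 2 → ℝ} (hx : x ∈ box) :
    0 ≤ sectorFun (1 + X ^ 3) x := by
  have ht := mul_mem_Ioo hx
  have hb := den_pos hx
  have h3 : 0 ≤ (x 0 * x 1) ^ 3 := pow_nonneg ht.1.le 3
  simp only [sectorFun, map_add, map_one, map_pow, Polynomial.aeval_X]
  exact div_nonneg (by linarith) hb.le

theorem sectorFun_four_X_nonneg {x : Fin 2 → ℝ} (hx : x ∈ box) : 0 ≤ sectorFun (4 * X) x := by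
  have ht := mul_mem_Ioo hx
  have hb := den_pos hx
  simp only [sectorFun, map_mul, map_ofNat, Polynomial.aeval_X]
  exact div_nonneg (by linarith [ht.1]) hb.le

/-- `posMass` does not separate the POSITIVE pair of §4/§10 (both integrands are `≥ 0` on the box, so
their positive-part masses are their equal values) — consistent with `pair_mem_changeOfVariablesRel`:
the invariant detects the need for rule (1b)/(3) only through sign changes of the integrand. -/
theorem posMass_pair_eq :
    posMass (KZ.of (sectorRep (1 + X ^ 3))) = posMass (KZ.of (sectorRep (4 * X))) := by
  rw [posMass_eq_value_of_nonneg _ fun x hx => sectorFun_one_add_X_pow_three_nonneg hx,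
    posMass_eq_value_of_nonneg _ fun x hx => sectorFun_four_X_nonneg hx,
    value_sectorRep_one_add_X_pow_three_eq]

end Scissors

/-! ## §13 (cycle 5) The CDT-free residue of the crux: a kernel statement on `ℚ³`

Unconditionally (the targets of §6 being theorems, §7), the conclusion of the crux is EQUIVALENT to:
every rational syzygy `A + B·H₃ + C·H₅ = 0` of the three normal-form values is realised by the
moves, i.e. `[box, nfP (A,B,C)] ∈ relations` (`conclusion_iff_kernel`).  CDT says the syzygy
module is `0` (`cdt_iff_kernel_eq_zero`), which is how §7 closes; WITHOUT CDT the tree still knows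
`π²` and `L(2,χ₋₃)` irrational, so the syzygy module has rank `≤ 1`, and the crux minus CDT reads:
"either CDT, or the (then unique up to scale) relation `g₀ + g₁π² + g₂L = 0` is a KZ relation of
`[box, nfP (g₀, −8g₂, 216g₁ + 32g₂)]`" — a statement nobody can attack from either side today.
This is the exact sense in which CDT is load-bearing for PROVABILITY (§2, §11) and not for TRUTH. -/

section Kernel

open Polynomial

/-- `[box, 0/(1−t⁶)]` is a relation. -/
theorem of_sectorRep_zero_mem : KZ.of (sectorRep (0 : ℚ[X])) ∈ KZ.relations :=
  KZ.of_mem_relations_of_eqOn_zero _ fun x _ => by simp [sectorFun]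

/-- **Kernel form of the conclusion** (unconditional): `Conclusion ↔` every zero-valued normal
form is a relation. -/
theorem conclusion_iff_kernel : Conclusion ↔
    ∀ v : ℚ × ℚ × ℚ, (sectorRep (nfP v)).value = 0 → KZ.of (sectorRep (nfP v)) ∈ KZ.relations := by
  rw [conclusion_iff_sectorRep]
  constructor
  · intro h v hv
    have h1 : KZ.of (sectorRep (nfP v)) - KZ.of (sectorRep 0) ∈ KZ.relations :=
      h (nfP v) 0 (by rw [hv, value_sectorRep_zero'])
    have : KZ.of (sectorRep (nfP v)) = (KZ.of (sectorRep (nfP v)) - KZ.of (sectorRep 0)) +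
        KZ.of (sectorRep (0 : ℚ[X])) := by abel
    rw [this]
    exact KZ.relations.add_mem h1 of_sectorRep_zero_mem
  · intro h P P' hv
    have hP := cls_eq_cls_nfP targets P
    have hP' := cls_eq_cls_nfP targets P'
    have hvP : (sectorRep P).value = (sectorRep (nfP (N P))).value :=
      KZ.Equivalent.value_eq_holds ((cls_eq_cls_iff _ _).mp hP)
    have hvP' : (sectorRep P').value = (sectorRep (nfP (N P'))).value :=
      KZ.Equivalent.value_eq_holds ((cls_eq_cls_iff _ _).mp hP')
    have hk : (sectorRep (nfP (N P - N P'))).value = 0 := by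
      rw [nfP_sub, value_sectorRep_sub, ← hvP, ← hvP', hv, sub_self]
    have hrel := h _ hk
    have hcls : cls (nfP (N P)) - cls (nfP (N P')) = 0 := by
      rw [← show cls (nfP (N P) - nfP (N P')) = cls (nfP (N P)) - cls (nfP (N P')) from
        map_sub clsHom _ _, ← nfP_sub]
      exact (QuotientAddGroup.eq_zero_iff _).mpr hrel
    rw [← cls_eq_cls_iff, hP, hP']
    exact sub_eq_zero.mp hcls

/-- The value of a normal form vanishes iff its coefficients are a syzygy of `(1, H₃, H₅)`. -/
theorem value_nfP_eq_zero_iff (v : ℚ × ℚ × ℚ) : (sectorRep (nfP v)).value = 0 ↔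
    (v.1 : ℝ) + v.2.1 * (-(L2chi3 / 8) + Real.pi ^ 2 / 54) + v.2.2 * (Real.pi ^ 2 / 216) = 0 := by
  rw [value_sectorRep_nfP]

/-- **CDT ↔ the syzygy module is zero** (so under CDT the kernel statement is vacuous — §7). -/
theorem cdt_iff_kernel_eq_zero : calegariDimitrovTang_linearIndependent ↔
    ∀ v : ℚ × ℚ × ℚ, (sectorRep (nfP v)).value = 0 → v = 0 := by
  constructor
  · intro hCDT v hv
    refine nfP_rigid hCDT (v := v) (w := 0) ?_
    rw [hv, value_sectorRep_nfP]
    simp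
  · intro h
    refine cdt_of_nfRigidity fun v w hvw => ?_
    have : (sectorRep (nfP (v - w))).value = 0 := by
      rw [nfP_sub, value_sectorRep_sub, hvw, sub_self]
    exact sub_eq_zero.mp (h _ this)

/-- The kernel statement is `ℚ`-homogeneous: it suffices to kill ONE generator of each rational
line of syzygies (rescaling by `KZ.scale`). -/
theorem kernel_smul {v : ℚ × ℚ × ℚ} (h : KZ.of (sectorRep (nfP v)) ∈ KZ.relations) (q : ℚ) :
    KZ.of (sectorRep (nfP (q • v))) ∈ KZ.relations := by
  have h1 : cls (nfP v) = 0 := (QuotientAddGroup.eq_zero_iff _).mpr h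
  have h2 : cls (nfP (q • v)) = 0 := by
    rw [nfP_smul, cls_smul, h1, map_zero]
  exact (QuotientAddGroup.eq_zero_iff _).mp h2

/-- The syzygy module is a proper subspace of `ℚ³`: `(1,0,0)` is not a syzygy (the box has volume
`1`), so a syzygy with `B = C = 0` vanishes.  (With the tree's irrationality of `π² = 216·H₅` one gets
rank `≤ 1` — two independent rational syzygies would force `(1, H₃, H₅)` onto a rational line — and CDT
is exactly rank `0`, `cdt_iff_kernel_eq_zero`; only the weak form is recorded here.) -/
theorem kernel_fst_eq_zero {v : ℚ × ℚ × ℚ} (hv : (sectorRep (nfP v)).value = 0)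
    (hB : v.2.1 = 0) (hC : v.2.2 = 0) : v = 0 := by
  rw [value_nfP_eq_zero_iff, hB, hC] at hv
  simp only [Rat.cast_zero, zero_mul, add_zero, Rat.cast_eq_zero] at hv
  exact Prod.ext hv (Prod.ext hB hC)

/-- **The crux, CDT-free**: `SectorTwoSix` is (unconditionally) equivalent to
"CDT ⇒ every syzygy is a relation"; and since CDT kills all syzygies this is how it is proved.
Read contrapositively: were CDT false, the crux would demand a move chain realising the
exotic relation among `1, π², L(2,χ₋₃)` — the only place where the hypothesis works. -/
theorem sectorTwoSix_iff_kernel : SectorTwoSix ↔ (calegariDimitrovTang_linearIndependent →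
    ∀ v : ℚ × ℚ × ℚ, (sectorRep (nfP v)).value = 0 → KZ.of (sectorRep (nfP v)) ∈ KZ.relations) := by
  rw [crux_iff]
  exact imp_congr_right fun _ => conclusion_iff_kernel

end Kernel

section KernelRank

open Polynomial

/-- A syzygy in the coordinates `(1, π², L)`: `A + B·H₃ + C·H₅ = 0` iff
`A + (B/54 + C/216)·π² − (B/8)·L = 0`. -/
theorem value_nfP_eq_zero_iff' (v : ℚ × ℚ × ℚ) : (sectorRep (nfP v)).value = 0 ↔
    (v.1 : ℝ) + (v.2.1 / 54 + v.2.2 / 216) * Real.pi ^ 2 - v.2.1 / 8 * L2chi3 = 0 := by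
  rw [value_sectorRep_nfP]
  constructor <;> intro h <;> linarith

/-- **Unconditionally, every non-zero syzygy involves `H₃`** (i.e. `L(2,χ₋₃)`): a syzygy with
`B = 0` is `A + (C/216)π² = 0`, which forces `A = C = 0` by the irrationality of `π²` — PROVED in
the tree from Lindemann (`CalegariDimitrovTang.eq_zero_of_add_mul_pi_sq_eq_zero`). -/
theorem kernel_eq_zero_of_snd_eq_zero {v : ℚ × ℚ × ℚ} (hv : (sectorRep (nfP v)).value = 0)
    (hB : v.2.1 = 0) : v = 0 := by
  rw [value_nfP_eq_zero_iff', hB] at hv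
  simp only [Rat.cast_zero, zero_div, zero_add, zero_mul, sub_zero] at hv
  obtain ⟨h1, h2⟩ := CalegariDimitrovTang.eq_zero_of_add_mul_pi_sq_eq_zero v.1 (v.2.2 / 216)
    (by push_cast; linarith)
  have hC : v.2.2 = 0 := by linarith
  exact Prod.ext h1 (Prod.ext hB hC)

/-- **The syzygy module has rank `≤ 1`, unconditionally**: two syzygies are proportional
(`B_w • v = B_v • w`). So "the" exotic relation among `1, π², L(2,χ₋₃)` — if CDT failed — is
unique up to scale, and by `kernel_smul` the CDT-free residue of the crux is ONE membership
`[box, nfP v₀] ∈ relations`. -/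
theorem kernel_rank_le_one {v w : ℚ × ℚ × ℚ} (hv : (sectorRep (nfP v)).value = 0)
    (hw : (sectorRep (nfP w)).value = 0) : w.2.1 • v = v.2.1 • w := by
  have hvw : (sectorRep (nfP (w.2.1 • v - v.2.1 • w))).value = 0 := by
    rw [value_sectorRep_nfP]
    rw [value_sectorRep_nfP] at hv hw
    simp only [Prod.fst_sub, Prod.snd_sub, Prod.smul_fst, Prod.smul_snd, smul_eq_mul, Rat.cast_sub,
      Rat.cast_mul]
    have e1 := congrArg (fun t => (w.2.1 : ℝ) * t) hv
    have e2 := congrArg (fun t => (v.2.1 : ℝ) * t) hw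
    simp only [mul_zero] at e1 e2
    linarith
  have h0 := kernel_eq_zero_of_snd_eq_zero hvw (by simp [mul_comm])
  exact sub_eq_zero.mp h0

/-- A non-zero syzygy writes `L(2,χ₋₃) ∈ ℚ + ℚπ²` — the exact negation of CDT in the tree's reduced
form (`CalegariDimitrovTang.linearIndependent_iff_forall_ne`). -/
theorem L2chi3_mem_of_kernel {v : ℚ × ℚ × ℚ} (hv : (sectorRep (nfP v)).value = 0) (hv0 : v ≠ 0) :
    ∃ p q : ℚ, L2chi3 = (p : ℝ) + q * Real.pi ^ 2 := by
  have hB : v.2.1 ≠ 0 := fun hB => hv0 (kernel_eq_zero_of_snd_eq_zero hv hB)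
  have hB' : (v.2.1 : ℝ) ≠ 0 := by exact_mod_cast hB
  rw [value_nfP_eq_zero_iff'] at hv
  refine ⟨8 * v.1 / v.2.1, 8 * (v.2.1 / 54 + v.2.2 / 216) / v.2.1, ?_⟩
  push_cast
  field_simp
  linarith

/-- Conversely `¬ CDT` yields a non-zero syzygy. -/
theorem exists_kernel_ne_zero_of_not_cdt (h : ¬ calegariDimitrovTang_linearIndependent) :
    ∃ v : ℚ × ℚ × ℚ, (sectorRep (nfP v)).value = 0 ∧ v ≠ 0 := by
  rw [CalegariDimitrovTang.linearIndependent_iff_forall_ne] at h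
  push Not at h
  obtain ⟨p, q, hpq⟩ := h
  -- `L = p + qπ²`: take `B = −8`, then `A − (B/8)L + (B/54 + C/216)π² = A + L + (−8/54 + C/216)π²`
  --  `= (A + p) + (q − 4/27 + C/216)π²`; choose `A = −p`, `C = 216 (4/27 − q) = 32 − 216 q`.
  refine ⟨(-p, -8, 32 - 216 * q), ?_, ?_⟩
  · rw [value_nfP_eq_zero_iff', hpq]
    push_cast
    ring
  · intro h0
    have := congrArg (fun v : ℚ × ℚ × ℚ => v.2.1) h0
    norm_num at this


/-- **THE CDT-FREE DICHOTOMY (unconditional).** The conclusion of the crux holds iff EITHER CDT's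
Theorem 1 holds OR the KZ calculus itself realises the exotic relation: some non-zero syzygy `v₀`
(then unique up to scale, `kernel_rank_le_one`, and equivalent to `L(2,χ₋₃) ∈ ℚ + ℚπ²`,
`L2chi3_mem_of_kernel`) has `[box, nfP v₀/(1−t⁶)] ∈ relations`.  Under the crux's own antecedent
the second disjunct is void — which is the whole proof of §7 — and nobody can decide the second
disjunct without deciding CDT: this is the final form of "CDT is load-bearing for provability, not
for truth" (§2, §11, §13). -/
theorem conclusion_iff_cdt_or_exotic : Conclusion ↔ (calegariDimitrovTang_linearIndependent ∨
    ∃ v : ℚ × ℚ × ℚ, (sectorRep (nfP v)).value = 0 ∧ v ≠ 0 ∧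
      KZ.of (sectorRep (nfP v)) ∈ KZ.relations) := by
  rw [conclusion_iff_kernel]
  constructor
  · intro h
    by_cases hc : calegariDimitrovTang_linearIndependent
    · exact Or.inl hc
    · obtain ⟨v, hv, hv0⟩ := exists_kernel_ne_zero_of_not_cdt hc
      exact Or.inr ⟨v, hv, hv0, h v hv⟩
  · rintro (hc | ⟨v₀, hv₀, hv₀0, hrel⟩) v hv
    · have h0 : v = 0 := (cdt_iff_kernel_eq_zero.mp hc) v hv
      subst h0
      have : nfP (0 : ℚ × ℚ × ℚ) = 0 := by simp [nfP]
      rw [this]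
      exact of_sectorRep_zero_mem
    · have hB : v₀.2.1 ≠ 0 := fun hB => hv₀0 (kernel_eq_zero_of_snd_eq_zero hv₀ hB)
      have hprop : v₀.2.1 • v = v.2.1 • v₀ := kernel_rank_le_one hv hv₀
      have hv' : v = ((v₀.2.1)⁻¹ * v.2.1) • v₀ := by
        have := congrArg (fun u : ℚ × ℚ × ℚ => (v₀.2.1)⁻¹ • u) hprop
        simpa only [smul_smul, inv_mul_cancel₀ hB, one_smul] using this
      rw [hv']
      exact kernel_smul hrel _

/-- Read on the crux with its antecedent NEGATED: if CDT failed, `SectorTwoSix` would still be TRUE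
iff the calculus proves the exotic relation (no vacuity escape: the statement `¬CDT → (Conclusion ↔ ∃ …)`). -/
theorem conclusion_iff_exotic_of_not_cdt (hc : ¬ calegariDimitrovTang_linearIndependent) :
    Conclusion ↔ ∃ v : ℚ × ℚ × ℚ, (sectorRep (nfP v)).value = 0 ∧ v ≠ 0 ∧
      KZ.of (sectorRep (nfP v)) ∈ KZ.relations := by
  rw [conclusion_iff_cdt_or_exotic, or_iff_right hc]

end KernelRank



/-! ## §14 (cycle 5) The EXACT Newton–Leibniz-free move set: `{1b, 2}` suffices, and nothing less does

§7 proves the crux inside `KZ.relations`; §10 and §12 show that neither `closure (1a ∪ 1b)` nor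
`closure (1a ∪ 2)` contains all instances of the conclusion.  Here the positive counterpart is
made precise: the whole §6–§7 engine runs inside ANY sub-calculus `S ≤ relations` containing the
integrand-additivity and change-of-variables moves and stable under rational scaling
(`SubCalc S`), so under CDT the conclusion holds with `KZ.relations` replaced by
`S₁₂ = closure (integrandAddRel ∪ changeOfVariablesRel)` (`conclusionIn_oneB_two`): no domain
additivity, no Newton–Leibniz, no excursion outside the two moves.  Consequently, for the eight
sub-calculi `T ⊆ {1a, 1b, 2}` (`subcalc a b c`), the conclusion read in `closure T` holds iff
`{1b, 2} ⊆ T` (`nlFree_characterisation`: `←` under CDT by monotonicity, `→` unconditionally by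
§10/§12).  This is the sharp form of "which moves any proof must use" short of the barrier
question whether rule (3) can replace rule (2). -/

section SubEngine

open Polynomial

variable {n : ℕ}

/-- The conclusion of the crux read in a sub-calculus `S` (CDT antecedent dropped). -/
def ConclusionIn (S : AddSubgroup KZ.FormalRep) : Prop :=
  ∀ (r r' : KZ.IntegralRep 2) (P P' : Polynomial ℚ), r.domain = box → r'.domain = box →
    EqOn r.integrand (sectorFun P) r.domain → EqOn r'.integrand (sectorFun P') r'.domain →
    r.value = r'.value → KZ.of r - KZ.of r' ∈ S

theorem conclusionIn_mono {S S' : AddSubgroup KZ.FormalRep} (h : S ≤ S') (hS : ConclusionIn S) :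
    ConclusionIn S' :=
  fun r r' P P' hd hd' hf hf' hv => h (hS r r' P P' hd hd' hf hf' hv)

theorem conclusionIn_relations_iff : ConclusionIn KZ.relations ↔ Conclusion := Iff.rfl

/-- A sub-calculus good enough for the engine: contains the rule-(1b) and rule-(2) instances SUPPORTED
IN DIMENSION `≤ 2` (tree: `KZ.formalRepLE 2`), is stable under rational scaling, and is sound
(contained in `relations`).  The dimension restriction lets the truncated calculus `relationsLE 2` of
route DimensionBudget and the `{1b,2}`-moves-in-dimension-`≤ 2` sub-calculus qualify. -/
structure SubCalc (S : AddSubgroup KZ.FormalRep) : Prop where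
  integrandAdd : KZ.integrandAddRel ∩ (KZ.formalRepLE 2 : Set KZ.FormalRep) ⊆ S
  cov : KZ.changeOfVariablesRel ∩ (KZ.formalRepLE 2 : Set KZ.FormalRep) ⊆ S
  scale : ∀ (q : ℚ) {c : KZ.FormalRep}, c ∈ S → KZ.scale (q : ℝ) (isAlgebraic_ratCast q) c ∈ S
  le : S ≤ KZ.relations

variable {S : AddSubgroup KZ.FormalRep}

/-- Dimension bookkeeping: differences of dimension-2 generators are supported in dimension `≤ 2`. -/
theorem sub_mem_formalRepLE_two (a b : KZ.IntegralRep 2) : KZ.of a - KZ.of b ∈ KZ.formalRepLE 2 :=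
  (KZ.formalRepLE 2).sub_mem (KZ.of_mem_formalRepLE a le_rfl) (KZ.of_mem_formalRepLE b le_rfl)

theorem sub_sub_mem_formalRepLE_two (a b c : KZ.IntegralRep 2) :
    KZ.of a - KZ.of b - KZ.of c ∈ KZ.formalRepLE 2 :=
  (KZ.formalRepLE 2).sub_mem (sub_mem_formalRepLE_two a b) (KZ.of_mem_formalRepLE c le_rfl)

/-- A sub-calculus containing ALL rule-(1b) and rule-(2) instances qualifies a fortiori. -/
theorem SubCalc.of_subset (hI : KZ.integrandAddRel ⊆ S) (hC : KZ.changeOfVariablesRel ⊆ S)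
    (hs : ∀ (q : ℚ) {c : KZ.FormalRep}, c ∈ S → KZ.scale (q : ℝ) (isAlgebraic_ratCast q) c ∈ S)
    (hle : S ≤ KZ.relations) : SubCalc S :=
  ⟨fun _ hc => hI hc.1, fun _ hc => hC hc.1, hs, hle⟩

/-- A dimension-2 representation with integrand `0` on its domain lies in `S`
(`[r] − [r] − [r] ∈ integrandAddRel`). -/
theorem SubCalc.of_mem_of_eqOn_zero (hS : SubCalc S) (r : KZ.IntegralRep 2)
    (h : EqOn r.integrand 0 r.domain) : KZ.of r ∈ S := by
  have h1 : KZ.of r - KZ.of r - KZ.of r ∈ S :=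
    hS.integrandAdd ⟨⟨2, r, r, r, rfl, rfl, fun x hx => by simp [h hx], rfl⟩,
      sub_sub_mem_formalRepLE_two r r r⟩
  rw [sub_self, zero_sub] at h1
  simpa using S.neg_mem h1

/-- Congruence inside `S`: same (dimension-2) domain, integrands agreeing on it. -/
theorem SubCalc.of_sub_of_mem_of_eqOn (hS : SubCalc S) {r r' : KZ.IntegralRep 2}
    (hd : r'.domain = r.domain) (h : EqOn r.integrand r'.integrand r.domain) :
    KZ.of r - KZ.of r' ∈ S := by
  obtain ⟨z, hzd, hzi⟩ := KZ.exists_zeroRep r.isSemialgebraic_domain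
  have h1 : KZ.of r - KZ.of r' - KZ.of z ∈ S :=
    hS.integrandAdd ⟨⟨2, r, r', z, hd, hzd, fun x hx => by simp [hzi, h hx], rfl⟩,
      sub_sub_mem_formalRepLE_two r r' z⟩
  have h2 : KZ.of z ∈ S := hS.of_mem_of_eqOn_zero z (by simp [hzi, EqOn])
  have : KZ.of r - KZ.of r' = (KZ.of r - KZ.of r' - KZ.of z) + KZ.of z := by abel
  rw [this]
  exact S.add_mem h1 h2

/-- Rule-(2) generators between dimension-2 representations, fed to `S`. -/
theorem SubCalc.cov₂ (hS : SubCalc S) {a b : KZ.IntegralRep 2}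
    (h : KZ.of a - KZ.of b ∈ KZ.changeOfVariablesRel) : KZ.of a - KZ.of b ∈ S :=
  hS.cov ⟨h, sub_mem_formalRepLE_two a b⟩

/-- `relations` itself is a `SubCalc`. -/
theorem subCalc_relations : SubCalc KZ.relations :=
  SubCalc.of_subset KZ.integrandAddRel_subset_relations KZ.changeOfVariablesRel_subset_relations
    (fun _ _ hc => KZ.scale_mem_relations _ _ hc) le_rfl

/-- **The truncated calculus `relationsLE 2`** (route DimensionBudget's `K_≤2`: moves among
representations of dimension `≤ 2` only) is a `SubCalc` (tree: `KZ.scale_mem_relationsLE`). -/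
theorem subCalc_relationsLE_two : SubCalc (KZ.relationsLE 2) where
  integrandAdd := fun _ hc => KZ.movesLE_subset_relationsLE 2 ⟨Or.inl (Or.inl (Or.inr hc.1)), hc.2⟩
  cov := fun _ hc => KZ.movesLE_subset_relationsLE 2 ⟨Or.inl (Or.inr hc.1), hc.2⟩
  scale := fun _ _ hc => KZ.scale_mem_relationsLE _ _ hc
  le := KZ.relationsLE_le_relations 2

/-- The sharpest sub-calculus of all: rule-(1b) and rule-(2) instances supported in dimension `≤ 2`. -/
def S12d2 : AddSubgroup KZ.FormalRep :=
  AddSubgroup.closure ((KZ.integrandAddRel ∪ KZ.changeOfVariablesRel) ∩ (KZ.formalRepLE 2 : Set KZ.FormalRep))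

theorem S12d2_le_relationsLE_two : S12d2 ≤ KZ.relationsLE 2 :=
  (AddSubgroup.closure_le _).mpr fun _ hc => KZ.movesLE_subset_relationsLE 2
    ⟨hc.1.elim (fun h => Or.inl (Or.inl (Or.inr h))) fun h => Or.inl (Or.inr h), hc.2⟩

/-- `S12d2` is a `SubCalc`. -/
theorem subCalc_S12d2 : SubCalc S12d2 where
  integrandAdd := fun _ hc => AddSubgroup.subset_closure ⟨Or.inl hc.1, hc.2⟩
  cov := fun _ hc => AddSubgroup.subset_closure ⟨Or.inr hc.1, hc.2⟩
  scale := by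
    intro q c hc
    have h : S12d2 ≤ S12d2.comap (KZ.scale (q : ℝ) (isAlgebraic_ratCast q)) :=
      (AddSubgroup.closure_le _).mpr fun x hx => by
        simp only [AddSubgroup.coe_comap, mem_preimage, SetLike.mem_coe]
        refine AddSubgroup.subset_closure ⟨?_, KZ.scale_mem_formalRepLE _ _ hx.2⟩
        rcases hx.1 with h1 | h1
        · exact Or.inl (KZ.scale_mem_integrandAddRel _ _ h1)
        · exact Or.inr (KZ.scale_mem_changeOfVariablesRel _ _ h1)
    exact h hc
  le := S12d2_le_relationsLE_two.trans (KZ.relationsLE_le_relations 2)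

/-- The `{1b, 2}` sub-calculus. -/
def S12 : AddSubgroup KZ.FormalRep := AddSubgroup.closure (KZ.integrandAddRel ∪ KZ.changeOfVariablesRel)

/-- `S₁₂` is a `SubCalc` (scaling maps each generator to a generator of the same kind, tree:
`KZ.scale_mem_integrandAddRel`, `KZ.scale_mem_changeOfVariablesRel`). -/
theorem subCalc_S12 : SubCalc S12 := by
  refine SubCalc.of_subset (fun _ hc => AddSubgroup.subset_closure (Or.inl hc))
    (fun _ hc => AddSubgroup.subset_closure (Or.inr hc)) (fun q c hc => ?_)
    ((AddSubgroup.closure_le _).mpr ?_)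
  · have h : S12 ≤ S12.comap (KZ.scale (q : ℝ) (isAlgebraic_ratCast q)) :=
      (AddSubgroup.closure_le _).mpr fun x hx => by
        simp only [AddSubgroup.coe_comap, mem_preimage, SetLike.mem_coe]
        rcases hx with hx | hx
        · exact AddSubgroup.subset_closure (Or.inl (KZ.scale_mem_integrandAddRel _ _ hx))
        · exact AddSubgroup.subset_closure (Or.inr (KZ.scale_mem_changeOfVariablesRel _ _ hx))
    exact h hc
  · rintro c (hc | hc)
    · exact KZ.integrandAddRel_subset_relations hc
    · exact KZ.changeOfVariablesRel_subset_relations hc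

theorem S12d2_le_S12 : S12d2 ≤ S12 := AddSubgroup.closure_mono fun _ hc => hc.1

/-! ### The class map into `FormalRep ⧸ S` -/

/-- The class of `[box, P/(1−t⁶)]` modulo `S`. -/
def clsS (S : AddSubgroup KZ.FormalRep) (P : ℚ[X]) : KZ.FormalRep ⧸ S :=
  ((KZ.of (sectorRep P) : KZ.FormalRep) : KZ.FormalRep ⧸ S)

theorem clsS_eq_clsS_iff (P P' : ℚ[X]) :
    clsS S P = clsS S P' ↔ KZ.of (sectorRep P) - KZ.of (sectorRep P') ∈ S :=
  QuotientAddGroup.eq_iff_sub_mem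

theorem SubCalc.clsS_add (hS : SubCalc S) (P P' : ℚ[X]) : clsS S (P + P') = clsS S P + clsS S P' := by
  have h : KZ.of (sectorRep (P + P')) - KZ.of (sectorRep P) - KZ.of (sectorRep P') ∈ S :=
    hS.integrandAdd ⟨⟨2, sectorRep (P + P'), sectorRep P, sectorRep P', rfl, rfl,
      fun x _ => by simp [sectorFun, add_div], rfl⟩, sub_sub_mem_formalRepLE_two _ _ _⟩
  rw [sub_sub] at h
  exact QuotientAddGroup.eq_iff_sub_mem.mpr h

theorem SubCalc.clsS_zero (hS : SubCalc S) : clsS S 0 = 0 :=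
  (QuotientAddGroup.eq_zero_iff _).mpr (hS.of_mem_of_eqOn_zero _ fun x _ => by simp [sectorFun])

/-- The class map as an additive homomorphism. -/
def SubCalc.clsSHom (hS : SubCalc S) : ℚ[X] →+ KZ.FormalRep ⧸ S where
  toFun := clsS S
  map_zero' := hS.clsS_zero
  map_add' := hS.clsS_add

@[simp] theorem SubCalc.clsSHom_apply (hS : SubCalc S) (P : ℚ[X]) : hS.clsSHom P = clsS S P := rfl

/-- `KZ.scale` descends to `FormalRep ⧸ S`. -/
def SubCalc.scaleQS (hS : SubCalc S) (c : ℚ) : KZ.FormalRep ⧸ S →+ KZ.FormalRep ⧸ S :=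
  QuotientAddGroup.map S S (KZ.scale (c : ℝ) (isAlgebraic_ratCast c)) fun _ hx => hS.scale c hx

theorem SubCalc.scaleQS_mk (hS : SubCalc S) (c : ℚ) (x : KZ.FormalRep) :
    hS.scaleQS c (x : KZ.FormalRep ⧸ S) =
      ((KZ.scale (c : ℝ) (isAlgebraic_ratCast c) x : KZ.FormalRep) : KZ.FormalRep ⧸ S) := rfl

theorem SubCalc.clsS_smul (hS : SubCalc S) (c : ℚ) (P : ℚ[X]) :
    clsS S (c • P) = hS.scaleQS c (clsS S P) := by
  rw [clsS, clsS, hS.scaleQS_mk, KZ.scale_of]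
  refine QuotientAddGroup.eq_iff_sub_mem.mpr (hS.of_sub_of_mem_of_eqOn rfl fun x _ => ?_)
  simp [sectorFun, Rat.smul_def, mul_div_assoc]

/-! ### The single-move targets as rule-(2) GENERATORS -/

/-- `[box, tᵏ] − [box, (k+1)⁻²]` is ONE change of variables (`m = k+1`, constant target). -/
theorem tMono_mem_changeOfVariablesRel (k : ℕ) :
    KZ.of (monoRep k) - KZ.of (constRep (1 / ((k : ℚ) + 1) ^ 2)) ∈ KZ.changeOfVariablesRel := by
  refine dilation_mem_changeOfVariablesRel (n := 2) (m := k + 1) (by omega) (monoRep k)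
      (constRep (1 / ((k : ℚ) + 1) ^ 2)) rfl rfl fun x hx => ?_
  simp only [monoRep_integrand, constRep_integrand, Nat.add_sub_cancel, prod_fin_two]
  push_cast
  have hk : ((k : ℝ) + 1) ≠ 0 := by positivity
  field_simp
  ring

/-- The `m = 3` dilation target is ONE change of variables. -/
theorem tDil3_mem_changeOfVariablesRel (r : ℕ) :
    KZ.of (sectorRep (9 * X ^ (3 * r + 2))) - KZ.of (sectorRep (X ^ r + X ^ (r + 2) + X ^ (r + 4))) ∈
      KZ.changeOfVariablesRel := by
  refine dilation_mem_changeOfVariablesRel (n := 2) (m := 3) (by norm_num) (sectorRep (9 * X ^ (3 * r + 2)))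
      (sectorRep (X ^ r + X ^ (r + 2) + X ^ (r + 4))) rfl rfl fun x hx => ?_
  have ht := mul_mem_Ioo hx
  have hd : 1 - (x 0 * x 1) ^ 6 ≠ 0 := (den_pos hx).ne'
  have hd3 : 1 - (x 0 ^ 3 * x 1 ^ 3) ^ 6 ≠ 0 := by
    have h3 : x 0 ^ 3 * x 1 ^ 3 = (x 0 * x 1) ^ 3 := by ring
    have : (x 0 ^ 3 * x 1 ^ 3) ^ 6 < 1 := by
      rw [h3, ← pow_mul]
      exact pow_lt_one₀ ht.1.le ht.2 (by norm_num)
    linarith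
  simp only [sectorRep_integrand, sectorFun, map_mul, map_ofNat, map_pow, aeval_X, map_add,
    prod_fin_two, Nat.reduceSub]
  rw [div_eq_iff hd, div_mul_eq_mul_div, div_mul_eq_mul_div, eq_div_iff hd3]
  ring

/-! ### Reduction to the normal form inside `S` -/

theorem SubCalc.clsS_X_pow_add_six (hS : SubCalc S) (k : ℕ) :
    clsS S (X ^ (k + 6)) = clsS S (X ^ k) - clsS S (C (1 / ((k : ℚ) + 1) ^ 2) * (1 - X ^ 6)) := by
  have h1 : KZ.of (sectorRep (X ^ k - X ^ (k + 6))) - KZ.of (monoRep k) ∈ S := by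
    refine hS.of_sub_of_mem_of_eqOn rfl fun x hx => ?_
    have hd : 1 - (x 0 * x 1) ^ 6 ≠ 0 := (den_pos hx).ne'
    simp only [sectorRep_integrand, sectorFun, map_sub, map_pow, aeval_X, monoRep_integrand]
    rw [div_eq_iff hd]
    ring
  have h2 : KZ.of (constRep (1 / ((k : ℚ) + 1) ^ 2)) -
      KZ.of (sectorRep (C (1 / ((k : ℚ) + 1) ^ 2) * (1 - X ^ 6))) ∈ S := by
    refine hS.of_sub_of_mem_of_eqOn rfl fun x hx => ?_
    have hd : 1 - (x 0 * x 1) ^ 6 ≠ 0 := (den_pos hx).ne'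
    simp only [constRep_integrand, sectorRep_integrand, sectorFun, map_mul, aeval_C, map_sub,
      map_one, map_pow, aeval_X]
    rw [mul_div_assoc, div_self hd, mul_one, eq_ratCast]
  have h3 : KZ.of (sectorRep (X ^ k - X ^ (k + 6))) -
      KZ.of (sectorRep (C (1 / ((k : ℚ) + 1) ^ 2) * (1 - X ^ 6))) ∈ S := by
    have : KZ.of (sectorRep (X ^ k - X ^ (k + 6))) -
        KZ.of (sectorRep (C (1 / ((k : ℚ) + 1) ^ 2) * (1 - X ^ 6))) =
        (KZ.of (sectorRep (X ^ k - X ^ (k + 6))) - KZ.of (monoRep k)) +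
          (KZ.of (monoRep k) - KZ.of (constRep (1 / ((k : ℚ) + 1) ^ 2))) +
          (KZ.of (constRep (1 / ((k : ℚ) + 1) ^ 2)) -
            KZ.of (sectorRep (C (1 / ((k : ℚ) + 1) ^ 2) * (1 - X ^ 6)))) := by abel
    rw [this]
    exact S.add_mem (S.add_mem h1 (hS.cov₂ (tMono_mem_changeOfVariablesRel k))) h2
  have h4 : clsS S (X ^ k - X ^ (k + 6)) = clsS S (C (1 / ((k : ℚ) + 1) ^ 2) * (1 - X ^ 6)) :=
    QuotientAddGroup.eq_iff_sub_mem.mpr h3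
  have h5 : clsS S (X ^ k - X ^ (k + 6)) = clsS S (X ^ k) - clsS S (X ^ (k + 6)) :=
    map_sub hS.clsSHom _ _
  rw [h5] at h4
  rw [← h4]
  abel

theorem SubCalc.clsS_eq_of_dil2 (hS : SubCalc S) (r : ℕ) :
    4 • clsS S (X ^ (2 * r + 1)) = clsS S (X ^ r) + clsS S (X ^ (r + 3)) := by
  have h1 : clsS S (4 * X ^ (2 * r + 1)) = clsS S (X ^ r + X ^ (r + 3)) :=
    QuotientAddGroup.eq_iff_sub_mem.mpr (hS.cov₂ (tDil2_mem_changeOfVariablesRel r))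
  rw [hS.clsS_add, show (4 : ℚ[X]) * X ^ (2 * r + 1) = 4 • X ^ (2 * r + 1) by simp [nsmul_eq_mul]] at h1
  rwa [show clsS S (4 • X ^ (2 * r + 1)) = 4 • clsS S (X ^ (2 * r + 1)) from
    map_nsmul hS.clsSHom _ _] at h1

theorem SubCalc.clsS_eq_of_dil3 (hS : SubCalc S) (r : ℕ) :
    9 • clsS S (X ^ (3 * r + 2)) = clsS S (X ^ r) + clsS S (X ^ (r + 2)) + clsS S (X ^ (r + 4)) := by
  have h1 : clsS S (9 * X ^ (3 * r + 2)) = clsS S (X ^ r + X ^ (r + 2) + X ^ (r + 4)) :=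
    QuotientAddGroup.eq_iff_sub_mem.mpr (hS.cov₂ (tDil3_mem_changeOfVariablesRel r))
  rw [hS.clsS_add, hS.clsS_add, show (9 : ℚ[X]) * X ^ (3 * r + 2) = 9 • X ^ (3 * r + 2) by
    simp [nsmul_eq_mul]] at h1
  rwa [show clsS S (9 • X ^ (3 * r + 2)) = 9 • clsS S (X ^ (3 * r + 2)) from
    map_nsmul hS.clsSHom _ _] at h1

/-- **Monomial reduction inside `S`**: `clsS (tᵏ) = clsS (nfP (N tᵏ))`. -/
theorem SubCalc.clsS_X_pow_eq (hS : SubCalc S) (k : ℕ) : clsS S (X ^ k) = clsS S (nfP (Nmono k)) := by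
  have e20 := hS.clsS_eq_of_dil2 0
  have e21 := hS.clsS_eq_of_dil2 1
  have e22 := hS.clsS_eq_of_dil2 2
  have e31 := hS.clsS_eq_of_dil3 1
  simp only [Nat.reduceMul, Nat.reduceAdd] at e20 e21 e22 e31
  have hint : ∀ (b c : ℤ), clsS S (nfP (0, (b : ℚ), (c : ℚ))) = b • clsS S (X ^ 3) + c • clsS S (X ^ 5) := by
    intro b c
    rw [nfP, hS.clsS_add, hS.clsS_add]
    simp only [map_zero, zero_mul, hS.clsS_zero, zero_add]
    rw [show C (b : ℚ) * X ^ 3 = b • (X ^ 3 : ℚ[X]) by simp [zsmul_eq_mul],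
      show C (c : ℚ) * X ^ 5 = c • (X ^ 5 : ℚ[X]) by simp [zsmul_eq_mul],
      show clsS S (b • (X ^ 3 : ℚ[X])) = b • clsS S (X ^ 3) from map_zsmul hS.clsSHom _ _,
      show clsS S (c • (X ^ 5 : ℚ[X])) = c • clsS S (X ^ 5) from map_zsmul hS.clsSHom _ _]
  induction k using Nat.strong_induction_on with
  | _ k ih =>
    rcases Nat.lt_or_ge k 6 with hk | hk
    · interval_cases k
      · have := hint (-5) 32
        simp only [Int.cast_neg, Int.cast_ofNat] at this
        rw [show Nmono 0 = (0, -5, 32) from rfl, this]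
        have hx1 : clsS S (X ^ 1) = 9 • clsS S (X ^ 5) - clsS S (X ^ 3) - clsS S (X ^ 5) := by
          rw [e31]; abel
        have hx0 : clsS S (X ^ 0) = 4 • clsS S (X ^ 1) - clsS S (X ^ 3) := by rw [e20]; abel
        rw [hx0, hx1]
        abel
      · have := hint (-1) 8
        simp only [Int.cast_neg, Int.cast_one, Int.cast_ofNat] at this
        rw [show Nmono 1 = (0, -1, 8) from rfl, this]
        have hx1 : clsS S (X ^ 1) = 9 • clsS S (X ^ 5) - clsS S (X ^ 3) - clsS S (X ^ 5) := by
          rw [e31]; abel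
        rw [hx1]
        abel
      · have := hint 0 3
        simp only [Int.cast_zero, Int.cast_ofNat] at this
        rw [show Nmono 2 = (0, 0, 3) from rfl, this]
        have hx2 : clsS S (X ^ 2) = 4 • clsS S (X ^ 5) - clsS S (X ^ 5) := by rw [e22]; abel
        rw [hx2]
        abel
      · have := hint 1 0
        simp only [Int.cast_one, Int.cast_zero] at this
        rw [show Nmono 3 = (0, 1, 0) from rfl, this]
        abel
      · have := hint 5 (-8)
        simp only [Int.cast_neg, Int.cast_ofNat] at this
        rw [show Nmono 4 = (0, 5, -8) from rfl, this]
        have hx1 : clsS S (X ^ 1) = 9 • clsS S (X ^ 5) - clsS S (X ^ 3) - clsS S (X ^ 5) := by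
          rw [e31]; abel
        have hx4 : clsS S (X ^ 4) = 4 • clsS S (X ^ 3) - clsS S (X ^ 1) := by rw [e21]; abel
        rw [hx4, hx1]
        abel
      · have := hint 0 1
        simp only [Int.cast_zero, Int.cast_one] at this
        rw [show Nmono 5 = (0, 0, 1) from rfl, this]
        abel
    · obtain ⟨j, rfl⟩ := Nat.exists_eq_add_of_le' hk
      rw [hS.clsS_X_pow_add_six j, ih j (by omega), show Nmono (j + 6) = Nmono j - _ from rfl, nfP_sub,
        show ∀ P P' : ℚ[X], clsS S (P - P') = clsS S P - clsS S P' from map_sub hS.clsSHom]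
      congr 2
      simp [nfP]

/-- **Reduction inside `S`**: every numerator is congruent to its normal form modulo `S`. -/
theorem SubCalc.clsS_eq_clsS_nfP (hS : SubCalc S) (P : ℚ[X]) : clsS S P = clsS S (nfP (N P)) := by
  induction P using Polynomial.induction_on' with
  | add p q hp hq => rw [hS.clsS_add, N_add, nfP_add, hS.clsS_add, hp, hq]
  | monomial k a =>
    rw [N_monomial, nfP_smul, hS.clsS_smul, ← hS.clsS_X_pow_eq k, ← hS.clsS_smul, smul_eq_C_mul,
      C_mul_X_pow_eq_monomial]

/-- **The conclusion inside `S`, under CDT.** -/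
theorem SubCalc.conclusionIn (hS : SubCalc S) (hCDT : calegariDimitrovTang_linearIndependent) :
    ConclusionIn S := by
  have key : ∀ P P' : ℚ[X], (sectorRep P).value = (sectorRep P').value →
      KZ.of (sectorRep P) - KZ.of (sectorRep P') ∈ S := by
    intro P P' hv
    have hP := hS.clsS_eq_clsS_nfP P
    have hP' := hS.clsS_eq_clsS_nfP P'
    have hvP : (sectorRep P).value = (sectorRep (nfP (N P))).value :=
      KZ.Equivalent.value_eq_holds (hS.le ((clsS_eq_clsS_iff _ _).mp hP))
    have hvP' : (sectorRep P').value = (sectorRep (nfP (N P'))).value :=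
      KZ.Equivalent.value_eq_holds (hS.le ((clsS_eq_clsS_iff _ _).mp hP'))
    have hN : N P = N P' := nfP_rigid hCDT (by rw [← hvP, ← hvP', hv])
    rw [← clsS_eq_clsS_iff, hP, hP', hN]
  intro r r' P P' hd hd' hf hf' hv
  have h1 : KZ.of r - KZ.of (sectorRep P) ∈ S :=
    hS.of_sub_of_mem_of_eqOn (by rw [sectorRep_domain, hd]) fun x hx => hf hx
  have h2 : KZ.of r' - KZ.of (sectorRep P') ∈ S :=
    hS.of_sub_of_mem_of_eqOn (by rw [sectorRep_domain, hd']) fun x hx => hf' hx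
  have hv1 : r.value = (sectorRep P).value := KZ.Equivalent.value_eq_holds (hS.le h1)
  have hv2 : r'.value = (sectorRep P').value := KZ.Equivalent.value_eq_holds (hS.le h2)
  have h3 := key P P' (by rw [← hv1, ← hv2, hv])
  have : KZ.of r - KZ.of r' = (KZ.of r - KZ.of (sectorRep P)) +
      (KZ.of (sectorRep P) - KZ.of (sectorRep P')) - (KZ.of r' - KZ.of (sectorRep P')) := by abel
  rw [this]
  exact S.sub_mem (S.add_mem h1 h3) h2

/-- **`{1b, 2}` suffices**: under CDT the conclusion of the crux holds with `KZ.relations` replaced by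
`closure (integrandAddRel ∪ changeOfVariablesRel)` — no domain additivity, no Newton–Leibniz. -/
theorem conclusionIn_oneB_two (hCDT : calegariDimitrovTang_linearIndependent) : ConclusionIn S12 :=
  subCalc_S12.conclusionIn hCDT

/-- Sanity: the engine at `S = relations` re-proves the crux. -/
theorem sectorTwoSix_via_subCalc : SectorTwoSix := fun hCDT => subCalc_relations.conclusionIn hCDT

/-- **Dimension budget 2 with rules (1b) + (2) only**: under CDT the conclusion holds inside
`S12d2 = closure ((integrandAddRel ∪ changeOfVariablesRel) ∩ formalRepLE 2)` — every move of the chain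
is an integrand-additivity or change-of-variables instance among representations of dimension `≤ 2`
(no domain additivity, no Newton–Leibniz, no excursion to dimension `≥ 3` or `≤ 1`). -/
theorem conclusionIn_S12d2 (hCDT : calegariDimitrovTang_linearIndependent) : ConclusionIn S12d2 :=
  subCalc_S12d2.conclusionIn hCDT

/-- Hence inside route DimensionBudget's truncated calculus `K_≤2`: equal-valued sector representations
are `KZ.EquivalentLE 2`. -/
theorem conclusionIn_relationsLE_two (hCDT : calegariDimitrovTang_linearIndependent) :
    ConclusionIn (KZ.relationsLE 2) :=
  conclusionIn_mono S12d2_le_relationsLE_two (conclusionIn_S12d2 hCDT)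

theorem equivalentLE_two (hCDT : calegariDimitrovTang_linearIndependent) (r r' : KZ.IntegralRep 2)
    (P P' : Polynomial ℚ) (hd : r.domain = box) (hd' : r'.domain = box)
    (hf : EqOn r.integrand (sectorFun P) r.domain) (hf' : EqOn r'.integrand (sectorFun P') r'.domain)
    (hv : r.value = r'.value) : KZ.EquivalentLE 2 r r' :=
  conclusionIn_relationsLE_two hCDT r r' P P' hd hd' hf hf' hv

/-! ### The eight Newton–Leibniz-free sub-calculi -/

/-- The sub-calculus generated by the selected move types among (1a), (1b), (2). -/
def subcalc (a b c : Bool) : AddSubgroup KZ.FormalRep :=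
  AddSubgroup.closure ((if a then KZ.domainAddRel else ∅) ∪ (if b then KZ.integrandAddRel else ∅) ∪
    (if c then KZ.changeOfVariablesRel else ∅))

theorem S12_le_subcalc (a : Bool) : S12 ≤ subcalc a true true :=
  AddSubgroup.closure_mono (by
    rintro x (hx | hx)
    · exact Or.inl (Or.inr hx)
    · exact Or.inr hx)

theorem subcalc_le_add (a c : Bool) (hc : c = false) (b : Bool) :
    subcalc a b c ≤ AddSubgroup.closure (KZ.domainAddRel ∪ KZ.integrandAddRel) := by
  subst hc
  refine AddSubgroup.closure_mono ?_
  rintro x ((hx | hx) | hx)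
  · cases a
    · simp at hx
    · exact Or.inl hx
  · cases b
    · simp at hx
    · exact Or.inr hx
  · simp at hx

theorem subcalc_le_scissors (a b : Bool) (hb : b = false) (c : Bool) :
    subcalc a b c ≤ AddSubgroup.closure (KZ.domainAddRel ∪ KZ.changeOfVariablesRel) := by
  subst hb
  refine AddSubgroup.closure_mono ?_
  rintro x ((hx | hx) | hx)
  · cases a
    · simp at hx
    · exact Or.inl hx
  · simp at hx
  · cases c
    · simp at hx
    · exact Or.inr hx


/-! ### The characterisation -/

/-- §10's and §12's sub-cruxes are `ConclusionIn` of the corresponding closures (`Iff.rfl`). -/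
theorem additiveConclusion_iff_conclusionIn :
    AdditiveConclusion ↔ ConclusionIn (AddSubgroup.closure (KZ.domainAddRel ∪ KZ.integrandAddRel)) :=
  Iff.rfl

theorem scissorsConclusion_iff_conclusionIn :
    ScissorsConclusion ↔ ConclusionIn (AddSubgroup.closure (KZ.domainAddRel ∪ KZ.changeOfVariablesRel)) :=
  Iff.rfl

/-- **Unconditional half**: a Newton–Leibniz-free sub-calculus proving the conclusion contains BOTH the
integrand-additivity and the change-of-variables moves (by §10 `not_additiveConclusion` and §12
`not_scissorsConclusion`, monotonicity). -/
theorem conclusionIn_subcalc_imp (a b c : Bool) (h : ConclusionIn (subcalc a b c)) :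
    b = true ∧ c = true := by
  cases b
  · exact absurd (conclusionIn_mono (subcalc_le_scissors a false rfl c) h) not_scissorsConclusion
  · cases c
    · exact absurd (conclusionIn_mono (subcalc_le_add a false rfl true) h) not_additiveConclusion
    · exact ⟨rfl, rfl⟩

/-- **THE EXACT NEWTON–LEIBNIZ-FREE MOVE SET.** Under CDT, for each of the eight sub-calculi generated
by a subset `T ⊆ {1a, 1b, 2}` of the Newton–Leibniz-free move types, the conclusion of the crux read in
`closure T` holds iff `{1b, 2} ⊆ T`.  (`→` is unconditional: `conclusionIn_subcalc_imp`; `←` is §14's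
engine in `S₁₂ = closure (1b ∪ 2)` plus monotonicity.)  Domain additivity (1a) is never needed and never
helps; whether Newton–Leibniz (3) could replace (2) is the barrier question
(`Literature.Barriers.KontsevichZagierPeriods.AlgebraicPrimitivesObstruction`), open. -/
theorem nlFree_characterisation (hCDT : calegariDimitrovTang_linearIndependent) (a b c : Bool) :
    ConclusionIn (subcalc a b c) ↔ (b = true ∧ c = true) := by
  refine ⟨conclusionIn_subcalc_imp a b c, ?_⟩
  rintro ⟨rfl, rfl⟩
  exact conclusionIn_mono (S12_le_subcalc a) (conclusionIn_oneB_two hCDT)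

/-- Read on the crux: `SectorTwoSix` is equivalent to its `{1b, 2}`-sub-calculus form. -/
theorem sectorTwoSix_iff_oneB_two :
    SectorTwoSix ↔ (calegariDimitrovTang_linearIndependent → ConclusionIn S12) :=
  ⟨fun _ hCDT => conclusionIn_oneB_two hCDT, fun h hCDT =>
    conclusionIn_mono subCalc_S12.le (h hCDT)⟩

end SubEngine



/-! ## §15 (cycle 5) Rule (3) never applies to a representation ON THE OPEN BOX directly

A Newton–Leibniz instance `[r] − [r']` has `r.domain` a BAND `{z | init z ∈ τ ∧ lo (init z) ≤ z_last ≤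
hi (init z)}` with CLOSED fibres, while the crux fixes `r.domain = (0,1)²`, whose fibres are open.  So
no generator of `newtonLeibnizRel` has a sector representation (or any representation on the open
box) as its band side (`box_ne_band`, `not_newtonLeibniz_band_of_domain_eq_box`): in ANY chain for
the crux, rule (3) can only enter after the open box has been traded for a closed band (rule 1a with
the null faces, cf. the route review) or through auxiliary representations — it is never the first
move on `[box, P/(1−t⁶)]`.  (The base side is unconstrained: `[box, f]` IS the base of the trivial
band `[box × [0,1], f ∘ init]`, primitive `t·f`, so this is a statement about the band side only.) -/

section NoBand

/-- The open unit box of `ℝⁿ⁺¹` is not a band over any base with any fibre bounds (its last-coordinate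
fibres are open intervals, a band's are closed): every dimension, so this applies verbatim to the Apéry
sector (`n + 1 = 3`) and to any box sector. -/
theorem boxN_ne_band (n : ℕ) (τ : Set (Fin n → ℝ)) (lo hi : (Fin n → ℝ) → ℝ) :
    boxN (n + 1) ≠ {z : Fin (n + 1) → ℝ | (Fin.init z : Fin n → ℝ) ∈ τ ∧ lo (Fin.init z) ≤ z (Fin.last n) ∧
      z (Fin.last n) ≤ hi (Fin.init z)} := by
  intro h
  -- the centre of the box lies in the band
  set c : Fin (n + 1) → ℝ := fun _ => 2⁻¹ with hc
  have hcb : c ∈ boxN (n + 1) := fun _ => by simp only [hc, mem_Ioo]; norm_num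
  rw [h] at hcb
  obtain ⟨hτ, hlo, hhi⟩ := hcb
  -- the top of the fibre through the centre lies in the band, hence in the box: `hi < 1`
  set d : Fin (n + 1) → ℝ := Fin.snoc (Fin.init c) (hi (Fin.init c)) with hd
  have hinit : Fin.init d = Fin.init c := by rw [hd, Fin.init_snoc]
  have hlast : d (Fin.last n) = hi (Fin.init c) := by rw [hd, Fin.snoc_last]
  have hdb : d ∈ boxN (n + 1) := by
    rw [h]
    refine ⟨by rw [hinit]; exact hτ, ?_, by rw [hlast, hinit]⟩
    rw [hinit, hlast]
    have : c (Fin.last n) = 2⁻¹ := rfl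
    linarith [hhi, hlo]
  have hhi1 : hi (Fin.init c) < 1 := by
    have := (hdb (Fin.last n)).2
    rwa [hlast] at this
  -- a point strictly between the top of the fibre and `1` lies in the box but not in the band
  set e : Fin (n + 1) → ℝ := Fin.snoc (Fin.init c) ((hi (Fin.init c) + 1) / 2) with he
  have heinit : Fin.init e = Fin.init c := by rw [he, Fin.init_snoc]
  have helast : e (Fin.last n) = (hi (Fin.init c) + 1) / 2 := by rw [he, Fin.snoc_last]
  have hc2 : (2⁻¹ : ℝ) ≤ hi (Fin.init c) := hhi
  have heb : e ∈ boxN (n + 1) := by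
    intro i
    refine Fin.lastCases ?_ (fun j => ?_) i
    · rw [helast]
      constructor <;> linarith
    · have : e (Fin.castSucc j) = Fin.init e j := rfl
      rw [this, heinit]
      show c (Fin.castSucc j) ∈ Ioo 0 1
      simp only [hc, mem_Ioo]; norm_num
  rw [h] at heb
  obtain ⟨-, -, hle⟩ := heb
  rw [helast, heinit] at hle
  linarith

/-- The crux's open box `(0,1)²` is not a band (`n + 1 = 2`). -/
theorem box_ne_band (τ : Set (Fin 1 → ℝ)) (lo hi : (Fin 1 → ℝ) → ℝ) :
    box ≠ {z : Fin 2 → ℝ | (Fin.init z : Fin 1 → ℝ) ∈ τ ∧ lo (Fin.init z) ≤ z (Fin.last 1) ∧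
      z (Fin.last 1) ≤ hi (Fin.init z)} :=
  boxN_ne_band 1 τ lo hi

/-- **No Newton–Leibniz generator has its band side on the open box**: for every representation `r`
on `(0,1)²` (in particular every sector representation of the crux) and every `r'`, the element
`[r] − [r']` is not WITNESSED as a Newton–Leibniz instance with `r` as the band (the data cannot even
satisfy the domain clause). Stated on the data to avoid free-group bookkeeping. -/
theorem not_newtonLeibniz_band_of_domain_eq_box (r : KZ.IntegralRep 2) (hr : r.domain = box)
    (r' : KZ.IntegralRep 1) (lo hi : (Fin 1 → ℝ) → ℝ) :
    r.domain ≠ {z : Fin 2 → ℝ | (Fin.init z : Fin 1 → ℝ) ∈ r'.domain ∧ lo (Fin.init z) ≤ z (Fin.last 1) ∧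
      z (Fin.last 1) ≤ hi (Fin.init z)} := by
  rw [hr]
  exact box_ne_band _ _ _

end NoBand


end Summit.KontsevichZagierPeriods.KontsevichZagierPeriods.Cruxes.SectorTwoSix.Disproof
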